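import Literature.AlgebraicGeometry.Resolution.WeightedBlowupNoIncrease
import Mathlib.Algebra.MvPolynomial.PDeriv
import HarnessLib

/-!
# Moh's bound at order `p` in every dimension: one point blow-up raises the shade by at most one

Topic: `Literature/AlgebraicGeometry/Resolution`. Reproduction (cell `pub-hironaka`, unit
`b2b-hironaka-cp4`, DIM-4 CENSUS gen 11; companion of `PointBlowupShade.lean`, whose predicate
`PointBlowup.MohBound p e j b s` — "Moh's bound as a PREDICATE … Not asserted here; the atlas
tests it row by row" — is PROVED here for `e = 1`) of:

* T. T. Moh, *On a stability theorem for local uniformization in characteristic `p`*,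
  Publ. RIMS Kyoto Univ. **23** (1987) 965–973 [Moh1987]: the ONE-BLOW-UP half of the
  "Stability Theorem" (Introduction, p. 966: for `z^{pᵉ} + ∏ xᵢ^{mᵢ} F(x₁,…,x_n) = 0`, "After a
  permissible blow-up … factor out `x₁` and let `F = x₁ᵈ F̄`. Then `ord F̄ ≤ d + p^{e−1}`"), proved
  there (§1) with Hasse derivations ("Proposition 1", "Proposition 2") in every number `n` of
  variables — here for `e = 1` and point blow-ups;
* H. Hauser, *On the problem of resolution of singularities in positive characteristic*,
  Bull. AMS **47** (2010) 1–30 [Hauser2010], §F "Proposition (Moh)" (p. 16: `W = 𝔸ⁿ`,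
  `f = x^{pᵉ} + yʳ·g(y)`, "`shade_{a′} f′ ≤ shade_a f + p^{e−1}`. In case `e = 1`, the inequality
  reads `shade_{a′} f′ ≤ shade_a f + 1` … The short proof of Moh uses a nice trick with
  derivations, thus eliminating all `p`th powers from `yʳg(y)`");
* H. Hauser, S. Perlega, *Characterizing the increase of the residual order under blowup in
  positive characteristic*, Publ. RIMS **55** (2019) 835–857 = arXiv:1906.09593
  [HauserPerlega2019PRIMS], §3 Theorem, assertions (2) "the order `o` of the coefficient ideal
  … is a multiple `w·c!` of `c!`", (7) "for `j ∉ T`, the variables `x_j` appear only as `pᵉ`-th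
  powers in `F(x)`", (9) "residual-order_{D′} J′ ≤ residual-order_D J + c!/p" and Comment (d)
  "The increase of the residual order can only happen if under the blowup at least two
  components of `D` are lost", all "in dimension `n+1`" arbitrary; Comment (h): "Assertion (2)
  and the bound in (9) have been known to Moh in the case of a purely inseparable hypersurface
  singularity". For `c = p` (so `e = 1`, `ℓ = 0`) their residual order is `(p−1)!` times
  Hauser's shade and `c!/p = (p−1)!`, i.e. the bound is `+1` on the shade.

## What is proved (all elementary; every field `K` of characteristic `p`, every finite index
## type `σ` of residual variables — i.e. hypersurfaces `x^p + F(y) = 0` of EVERY dimension)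

For a state `s = (F, r)` of `PointBlowupShade.lean` with `F` CLEANED (`deletePthPowers p F = F`,
no `p`-th power monomials), `y^r ∣ F` monomialwise and `ord₀ F ≥ p`, and ANY point `b` of the
exceptional divisor of the blow-up of the origin read in the `y_j`-chart (`b_j = 0`; no
equimultiplicity, perfectness or algebraic-closure hypothesis is needed):

* `PointBlowup.mohBound_one` — **`MohBound p 1 j b s`**: `shade(step p j b s) ≤ shade(s) + 1`.
* `PointBlowup.shade_step_le_of_not_dvd` — no increase if `p ∤ ord₀ F` (`= |r| + shade`;
  Hauser's condition (1) `OrderCondition`, HP (2) for `c = p`).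
* `PointBlowup.shade_step_le_of_not_dvd_apply` — no increase if some initial monomial `y^d` of
  `F` (`|d| = ord₀ F`) has `p ∤ d_i` at an index `i ≠ j` that is untranslated (`b_i = 0`) or
  non-exceptional (`r_i = 0`) (HP (7) for `c = p`, read in fixed coordinates).
* `PointBlowup.necessary_of_shadeIncreases` — hence an increase forces: `p ∣ ord₀ F`; every
  `y_i` (`i ≠ j`, `b_i = 0 ∨ r_i = 0`) occurs in the initial form of `F` with exponents `≡ 0
  (mod p)` only; and some EXCEPTIONAL component `{y_i = 0}` (`r_i ≥ 1`, `i ≠ j`) lost at `b`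
  (`b_i ≠ 0`) carries an initial exponent prime to `p` (with `{y_j = 0}`: "at least two
  components lost", HP Comment (d), when `r_j ≥ 1`).
* `PointBlowup.shade_succ_le_along` — along any sequence of such point blow-ups on which the
  order stays `≥ p` (cleanness and `y^r ∣ F` persist: `deletePthPowers_step`,
  `newMult_le_of_mem_support_step`; the order hypothesis is `le_ordZero_step_of_isEquimultiplePoint`)
  EVERY step satisfies `shade_{n+1} ≤ shade_n + 1`.
* `PointBlowup.exists_nonexceptional_of_shadeIncreases` — STRUCTURE AFTER AN INCREASE (Moh's
  "now `x_s` is an `X`-kind of variable", p. 972): a lost exceptional component `i₀` becomes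
  non-exceptional (`r′_{i₀} = 0`) and the new initial form has a monomial with exponent prime to
  `p` at `i₀`; the new order is exactly `|r′| + shade + 1`.
* `PointBlowup.shade_step_step_le_of_shadeIncreases` — hence the NEXT point blow-up does not
  increase the shade again in any chart `j′ ≠ i₀`, at any point where the order stayed `p`
  (Moh's case (2)); the chart `j′ = i₀` (Moh's case (1), a drop along the valuation) is not
  treated in general, but:
* `PointBlowup.consecutive_shadeIncreases` — constraints two consecutive increases would force
  (second chart = a lost exceptional component; `p` divides both orders; a third exceptional
  component kept at the first step and lost at the second), whence
  `not_consecutive_shadeIncreases_of_card_le_two` (surfaces) — both SUPERSEDED by: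
* **`PointBlowup.not_shadeIncreases_step_of_shadeIncreases` — NO TWO CONSECUTIVE INCREASES, in
  every dimension**: after an increase, the next point blow-up (any chart, any point of the new
  exceptional divisor with order still `p`) does not increase the shade. Key step (derived
  here): the initial monomial `y^E` of `F′` comes from an initial monomial `y^d` of `F` with
  `E_i = d_i ≡ 0 (mod p)` at every untranslated `i ≠ j` and `E_j ≡ 0`, so `p ∣ |E|` forces a
  SECOND translated index `i₂ ≠ i₀` with `p ∤ E_{i₂}`, non-exceptional in the new state.
* `PointBlowup.step_F_ne_zero`, `PointBlowup.shade_isolated_increases_along` — along a sequence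
  (order `p` throughout) the residual polynomial never vanishes, increases are isolated, and
  over any two consecutive steps the shade rises by at most one.

The bound `+1` is attained: Hauser's kangaroo point (characteristic `2`, two residual
variables; `Hauser2003_kangarooShadeIncrease`, `PointBlowup.shade_kangaroo_example`).

## Method (Moh's "trick with derivations", organised as two probes)

`∂/∂y_i` kills exactly the monomials with `p ∣ (exponent of y_i)`, commutes with the
translation (`pderiv_translate`) and, for `i ≠ j`, with the chart transform up to the shift by
`y_j` (`pderiv_monomial` on `chartTransform`); so a monomial of `∂G/∂y_i` (`G` the translated
chart transform) gives a monomial of `G` surviving the cleaning. The order of the relevant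
polynomials at the new point is controlled by the LAYER LEMMA
`exists_mem_support_translate_layer`: if `y^ρ` divides `P` and the lowest `y_j`-layer of `P`
(`b_j = 0`) has degrees `≤ |ρ| + D`, then `translate b P` has a monomial in that layer of degree
`≤ Σ_{b_i = 0} ρ_i + D` — the translated factor `∏_{b_i ≠ 0}(y_i + b_i)^{ρ_i}` is a unit.
Probe 1 (`p ∤ ord₀ F`): the layer `E_j = ord₀ F − p ≢ 0 (mod p)` of `G` itself. Probe 2
(`p ∣ ord₀ F`; cleanness gives an initial exponent prime to `p` at some `i₀ ≠ j`,
`exists_ne_not_dvd`): the lowest layer of `∂G/∂y_{i₀}`; the extra `+1` arises exactly when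
`i₀` is a lost exceptional component (`b_{i₀} ≠ 0`, `r_{i₀} ≥ 1`).

## What is NOT proved here (scope, honest)

* `e ≥ 2` (`q = pᵉ`, bound `+p^{e−1}`): needs Hasse derivatives (Moh's Proposition 1–2); not
  attempted. For `e ≥ 3` the SEQUENCE form of Moh's statement is false
  (`Literature.Barriers.ResolutionOfSingularities.mohStabilityClaim_false`, Hauser–Perlega 2019).
* The eventual bound along a whole sequence for `e = 1` ("it is known to be valid for `e = 1`",
  [HauserPerlega2019, §3]; "in the next blowup the shade has to drop at least by 1 (if `e = 1`)",
  [Hauser2010, §F]) — i.e. Moh's "`ord F̄` will not increase beyond `d + 1` until it drops to `d`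
  or less": NOT formalised IN THIS FILE beyond `not_shadeIncreases_step_of_shadeIncreases`
  (increases are isolated: the pattern `+1, +1` is impossible in every dimension; the pattern
  `+1, 0, +1` is not excluded here). It is PROVED in the sequel
  `PointBlowupMohStability.lean` (`PointBlowup.shade_le_shade_add_one_along`: along any sequence of
  point blow-ups on the equimultiple branch, `shade(s_m) ≤ shade(s_n) + 1` for all `n ≤ m`), by
  the witness structure of `exists_nonexceptional_of_shadeIncreases` below and a third probe.
* Centres of positive dimension (Hauser–Perlega's `S ⊋ T`; the tree's `CentreBlowup` of
  `PointBlowupShadeCentres.lean`) and HP's residue inequality (6) — not treated.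
* Nothing here is a statement about resolution of singularities; census value only (row O5 of
  the dimension-4 census of `pub-hironaka`: at multiplicity `p` the classical residual order
  cannot jump by more than one per point blow-up in ANY dimension, kernel-checked).

## Reading notes (faithfulness precisions recorded by the cell's referee, "R-Moh-1")

The model is COARSER and the theorems are STRONGER than the printed statements in two harmless
ways, which the reader should keep in mind when matching `mohBound_one` with [Hauser2010, §F]:
1. `Hauser2010.deletePthPowers` deletes the `p`-th power MONOMIALS of the translated chart
   transform. This realises Hauser's cleaning — the coordinate change `x ↦ x + h(y)` to a
   hypersurface of weak maximal contact; a term that "is a `p`th power (provided that `K` is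
   perfect) … does not count" [Hauser2010, §G p. 20] — only over a PERFECT ground field, where
   every monomial `c·y^{p·d}` is a `p`-th power (`exists_add_pow_eq_deletePthPowers`,
   `graphOrder_eq_ordZero_deletePthPowers`, `PointBlowup.graphShade_eq_shade` of
   `PointBlowupShade.lean`, all under `[PerfectRing K p]`). Over an imperfect field of
   characteristic `p` the number `State.shade` of the model is a coordinate-dependent quantity
   which the theorems of this file still bound, but it need not be Hauser's shade (the maximum of
   `ord(F + h^p) − |r|` over graphs); the census row O5 concerns perfect (indeed algebraically
   closed) residue fields, where the two agree.
2. The bound `shade′ ≤ shade + 1` is proved at EVERY point `b` of the exceptional divisor of the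
   chart, whereas the printed hypothesis is "`a′` an equiconstant point" [Hauser2010, §F
   Proposition]. At a non-equiconstant point the order of `x^p + F′` has dropped below `p`, the
   walk leaves the purely inseparable order-`p` regime, and the number bounded is not the
   resolution datum of the transform; the extra generality is therefore vacuous for the census
   and the statement is not weaker than the printed one. Correspondingly, the hypotheses actually
   used by the one-step theorem are `(p : ℕ∞) ≤ ord₀ F` (the centre is a `p`-fold point) and
   `y^r ∣ F` — the printed setting `f = x^p + y^r·g` — and NOT the equimultiplicity of the new
   point; along sequences (`shade_succ_le_along`) the hypothesis `∀ n, p ≤ ord₀ F_n` restricts to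
   the equimultiple branch, as in [Moh87] ("after we blow-up the permissible center") and
   [HauserPerlega2019, §3] ("a sequence of permissible blowups under which the order of the
   transforms of `f` remain constant").
-/

noncomputable section


open MvPolynomial Finset

open scoped BigOperators

namespace Literature.AlgebraicGeometry.Resolution

open Literature.AlgebraicGeometry.Resolution.Hauser2010
open Literature.Barriers.ResolutionOfSingularities
open Literature.AlgebraicGeometry.Resolution.WeightedBlowup

namespace PointBlowup

/-! ## 1. Chart exponents and multiplicities: pointwise formulas, degrees, injectivity -/

section Exponents

variable {σ : Type*} [Fintype σ] [DecidableEq σ]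

omit [Fintype σ] in
/-- The chart exponent, pointwise. [folklore] -/
theorem chartExponent_apply (q : ℕ) (j : σ) (d : σ →₀ ℕ) (i : σ) :
    chartExponent q j d i = if i = j then d.degree - q else d i := by
  unfold chartExponent
  rw [Finsupp.update_apply]

/-- `|d| = d_j + ∑_{i ≠ j} d_i`. [folklore] -/
theorem degree_eq_add_sum_erase (j : σ) (d : σ →₀ ℕ) :
    d.degree = d j + ∑ i ∈ univ.erase j, d i := by
  rw [Finsupp.degree_eq_sum, ← Finset.add_sum_erase _ _ (Finset.mem_univ j)]

/-- A coordinate other than `y_j` is bounded by `|d| − d_j`. [folklore] -/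
theorem apply_le_degree_sub {j i : σ} (h : i ≠ j) (d : σ →₀ ℕ) : d i ≤ d.degree - d j := by
  have h1 := degree_eq_add_sum_erase j d
  have h2 : d i ≤ ∑ k ∈ univ.erase j, d k :=
    Finset.single_le_sum (fun k _ => Nat.zero_le (d k)) (Finset.mem_erase.mpr ⟨h, Finset.mem_univ i⟩)
  omega

/-- The degree of the chart exponent: `|d^| = (|d| − q) + (|d| − d_j)`. [folklore] -/
theorem degree_chartExponent (q : ℕ) (j : σ) (d : σ →₀ ℕ) :
    (chartExponent q j d).degree = (d.degree - q) + (d.degree - d j) := by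
  rw [degree_eq_add_sum_erase j (chartExponent q j d), chartExponent_apply, if_pos rfl]
  have : ∑ i ∈ univ.erase j, chartExponent q j d i = ∑ i ∈ univ.erase j, d i :=
    Finset.sum_congr rfl fun i hi => by
      rw [chartExponent_apply, if_neg (Finset.ne_of_mem_erase hi)]
  rw [this]
  have h2 := degree_eq_add_sum_erase j d
  omega

/-- The chart exponent determines the exponent (on monomials of degree `≥ q`). [folklore] -/
theorem chartExponent_injective {q : ℕ} {j : σ} {d d' : σ →₀ ℕ} (hd : q ≤ d.degree)
    (hd' : q ≤ d'.degree) (h : chartExponent q j d = chartExponent q j d') : d = d' := by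
  have hne : ∀ i, i ≠ j → d i = d' i := fun i hi => by
    have := DFunLike.congr_fun h i
    rwa [chartExponent_apply, chartExponent_apply, if_neg hi, if_neg hi] at this
  have hj : d.degree - q = d'.degree - q := by
    have := DFunLike.congr_fun h j
    rwa [chartExponent_apply, chartExponent_apply, if_pos rfl, if_pos rfl] at this
  have hsum : ∑ i ∈ univ.erase j, d i = ∑ i ∈ univ.erase j, d' i :=
    Finset.sum_congr rfl fun i hi => hne i (Finset.ne_of_mem_erase hi)
  ext i
  by_cases hij : i = j
  · subst hij
    have h1 := degree_eq_add_sum_erase i d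
    have h2 := degree_eq_add_sum_erase i d'
    omega
  · exact hne i hij

/-- `|f.update j v| + f_j = |f| + v`. [folklore] -/
theorem degree_update_add (f : σ →₀ ℕ) (j : σ) (v : ℕ) :
    (f.update j v).degree + f j = f.degree + v := by
  rw [Finsupp.degree_eq_sum, Finsupp.degree_eq_sum, Finsupp.coe_update,
    Finset.sum_update_of_mem (Finset.mem_univ j), Finset.sdiff_singleton_eq_erase,
    ← Finset.add_sum_erase _ (⇑f) (Finset.mem_univ j)]
  ring

omit [Fintype σ] in
/-- Filtering commutes with updating at an index inside the filter. [folklore] -/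
theorem filter_update_of_pos (f : σ →₀ ℕ) {Z : σ → Prop} [DecidablePred Z] {j : σ} (hj : Z j)
    (v : ℕ) : (f.update j v).filter Z = (f.filter Z).update j v := by
  ext i
  simp only [Finsupp.filter_apply, Finsupp.update_apply]
  by_cases h : i = j
  · subst h; simp [hj]
  · simp [h]

end Exponents

/-! ## 2. Supports and coefficients of sums of monomials -/

section Support

variable {σ : Type*} {K : Type*} [Field K] [DecidableEq σ]

/-- The support of a sum of monomials. [folklore] -/
theorem exists_of_mem_support_sum_monomial {ι : Type*} (s : Finset ι) (f : ι → σ →₀ ℕ)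
    (g : ι → K) {e : σ →₀ ℕ}
    (he : e ∈ (∑ x ∈ s, monomial (f x) (g x) : MvPolynomial σ K).support) :
    ∃ x ∈ s, g x ≠ 0 ∧ f x = e := by
  by_contra hc
  push Not at hc
  rw [MvPolynomial.mem_support_iff, coeff_sum] at he
  apply he
  refine Finset.sum_eq_zero fun x hx => ?_
  rw [coeff_monomial]
  by_cases hfx : f x = e
  · rw [if_pos hfx]
    by_contra hg
    exact hc x hx hg hfx
  · rw [if_neg hfx]

/-- A coefficient of a sum of monomials with injective exponents (on the non-zero terms).
[folklore] -/
theorem coeff_sum_monomial_of_injOn {ι : Type*} (s : Finset ι) (f : ι → σ →₀ ℕ) (g : ι → K)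
    {x₀ : ι} (hx₀ : x₀ ∈ s) (hinj : ∀ x ∈ s, g x ≠ 0 → f x = f x₀ → x = x₀) :
    coeff (f x₀) (∑ x ∈ s, monomial (f x) (g x) : MvPolynomial σ K) = g x₀ := by
  rw [coeff_sum, Finset.sum_eq_single x₀]
  · rw [coeff_monomial, if_pos rfl]
  · intro x hx hne
    rw [coeff_monomial]
    by_cases h : f x = f x₀
    · rw [if_pos h]
      by_contra hg
      exact hne (hinj x hx hg h)
    · rw [if_neg h]
  · intro h
    exact (h hx₀).elim

end Support

/-! ## 3. Partial derivatives commute with translations -/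

section Derivative

variable {σ : Type*} {K : Type*} [Field K] [DecidableEq σ]

/-- Partial derivatives commute with translations. [folklore] -/
theorem pderiv_translate (b : σ → K) (i : σ) (P : MvPolynomial σ K) :
    pderiv i (translate b P) = translate b (pderiv i P) := by
  unfold translate
  induction P using MvPolynomial.induction_on with
  | C a => simp
  | add f g hf hg => rw [map_add, map_add, map_add, map_add, hf, hg]
  | mul_X f n hf =>
    rw [map_mul, aeval_X, pderiv_mul, hf, pderiv_mul, map_add, pderiv_C, add_zero,
      map_add (aeval _), map_mul (aeval _), map_mul (aeval _), aeval_X]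
    by_cases hn : n = i
    · subst hn
      rw [pderiv_X_self, map_one]
    · rw [pderiv_X_of_ne hn, map_zero]

end Derivative

/-! ## 4. Translations: Taylor support, injectivity, and the layer lemma -/

section Translate

variable {σ : Type*} {K : Type*} [Field K] [Fintype σ] [DecidableEq σ] [DecidableEq K]

omit [Fintype σ] [DecidableEq σ] [DecidableEq K] in
/-- A translation acts termwise on the monomial expansion. [folklore] -/
theorem translate_eq_sum_support (b : σ → K) (P : MvPolynomial σ K) :
    translate b P = ∑ e ∈ P.support, translate b (monomial e (coeff e P)) := by
  unfold translate
  rw [← map_sum]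
  congr 1
  exact P.as_sum

omit [Fintype σ] [DecidableEq σ] [DecidableEq K] in
/-- Translating back: `translate (−b) ∘ translate b = id`. [folklore] -/
theorem translate_neg_translate (b : σ → K) (P : MvPolynomial σ K) :
    translate (fun i => -b i) (translate b P) = P := by
  unfold translate
  rw [← AlgHom.comp_apply, MvPolynomial.comp_aeval]
  have h : (fun i => aeval (fun i => (X i + C (-b i) : MvPolynomial σ K))
      (X i + C (b i) : MvPolynomial σ K)) = X := by
    funext i
    simp only [map_add, aeval_X, algHom_C, algebraMap_eq, map_neg]
    ring
  rw [h, MvPolynomial.aeval_X_left, AlgHom.id_apply]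

omit [Fintype σ] [DecidableEq σ] [DecidableEq K] in
/-- Translation is injective; in particular it preserves non-vanishing. [folklore] -/
theorem translate_ne_zero (b : σ → K) {P : MvPolynomial σ K} (hP : P ≠ 0) :
    translate b P ≠ 0 := by
  intro h
  apply hP
  rw [← translate_neg_translate b P, h]
  simp [translate]

omit [DecidableEq K] in
/-- A monomial `y^β` of `(y + b)^e` satisfies `β ≤ e`. [folklore] -/
theorem le_of_coeff_translate_monomial_ne_zero (b : σ → K) {e β : σ →₀ ℕ} {a : K}
    (h : coeff β (translate b (monomial e a)) ≠ 0) : β ≤ e := by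
  rw [Finsupp.le_def]
  intro i
  by_contra hlt
  exact h (coeff_translate_monomial_eq_zero_of_lt b e β a (not_le.mp hlt))

omit [DecidableEq K] in
/-- At an untranslated variable (`b_j = 0`) the exponent is preserved: a monomial `y^β` of
`(y + b)^e` has `β_j = e_j`. [folklore] -/
theorem apply_eq_of_coeff_translate_monomial_ne_zero (b : σ → K) {j : σ} (hbj : b j = 0)
    {e β : σ →₀ ℕ} {a : K} (h : coeff β (translate b (monomial e a)) ≠ 0) : β j = e j := by
  have h1 : β j ≤ e j := Finsupp.le_def.mp (le_of_coeff_translate_monomial_ne_zero b h) j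
  rcases h1.lt_or_eq with hlt | heq
  · exact (h (coeff_translate_monomial_eq_zero_of_apply_eq_zero b e β a hbj hlt)).elim
  · exact heq

omit [DecidableEq K] in
/-- A monomial `y^β` of `translate b P` lies below some monomial of `P`. [folklore] -/
theorem exists_le_of_mem_support_translate (b : σ → K) (P : MvPolynomial σ K) {β : σ →₀ ℕ}
    (hβ : β ∈ (translate b P).support) : ∃ e ∈ P.support, β ≤ e := by
  by_contra hne
  push Not at hne
  rw [MvPolynomial.mem_support_iff, translate_eq_sum_support, coeff_sum] at hβ
  apply hβ
  refine Finset.sum_eq_zero fun e he => ?_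
  by_contra h
  exact hne e he (le_of_coeff_translate_monomial_ne_zero b h)

omit [DecidableEq σ] [DecidableEq K] in
/-- The degree is monotone on exponents. [folklore] -/
theorem degree_le_degree_of_le {β e : σ →₀ ℕ} (h : β ≤ e) : β.degree ≤ e.degree := by
  rw [Finsupp.degree_eq_sum, Finsupp.degree_eq_sum]
  exact Finset.sum_le_sum fun i _ => Finsupp.le_def.mp h i

omit [DecidableEq σ] [DecidableEq K] in
/-- The degree is strictly monotone on exponents. [folklore] -/
theorem degree_lt_degree_of_lt {β e : σ →₀ ℕ} (h : β < e) : β.degree < e.degree := by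
  obtain ⟨hle, hne⟩ := lt_iff_le_and_ne.mp h
  obtain ⟨i, hi⟩ : ∃ i, β i < e i := by
    by_contra hc
    push Not at hc
    exact hne (le_antisymm hle (Finsupp.le_def.mpr hc))
  rw [Finsupp.degree_eq_sum, Finsupp.degree_eq_sum]
  exact Finset.sum_lt_sum (fun k _ => Finsupp.le_def.mp hle k) ⟨i, Finset.mem_univ _, hi⟩

/-- **The layer lemma.** Let `P` be a polynomial all of whose monomials are divisible by `y^ρ`,
`b` a translation vector with `b_j = 0`, and suppose the monomials `y^e` of `P` with `e_j = ρ_j`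
(the lowest `y_j`-layer) form a non-empty set on which `|e| ≤ |ρ| + D`. Then `translate b P`
has a monomial `y^E` in the same layer (`E_j = ρ_j`) with
`|E| ≤ (∑_{i : b_i = 0} ρ_i) + D`: the factor `∏_{b_i ≠ 0} (y_i + b_i)^{ρ_i}` of
`translate b (y^ρ)` is a unit and does not contribute to the order. (Elementary; the mechanism
behind "the order of the strict transform at a point of the exceptional divisor is at most the
order below".) [folklore] -/
theorem exists_mem_support_translate_layer (b : σ → K) {j : σ} (hbj : b j = 0)
    (P : MvPolynomial σ K) (ρ : σ →₀ ℕ) (hρ : ∀ e ∈ P.support, ρ ≤ e) (D : ℕ)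
    (hD : ∀ e ∈ P.support, e j = ρ j → e.degree ≤ ρ.degree + D)
    (hlayer : ∃ e ∈ P.support, e j = ρ j) :
    ∃ E ∈ (translate b P).support,
      E j = ρ j ∧ E.degree ≤ (ρ.filter fun i => b i = 0).degree + D := by
  classical
  -- the layer part `P₀⁰` and the rest `P₀⁺` of `P / y^ρ`
  set L : Finset (σ →₀ ℕ) := P.support.filter fun e => e j = ρ j with hL
  set P00 : MvPolynomial σ K := ∑ e ∈ L, monomial (e - ρ) (coeff e P) with hP00
  set P0p : MvPolynomial σ K :=
    ∑ e ∈ P.support.filter (fun e => ¬ e j = ρ j), monomial (e - ρ) (coeff e P) with hP0p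
  have hPfac : P = monomial ρ 1 * (P00 + P0p) := by
    rw [hP00, hP0p, hL, Finset.sum_filter_add_sum_filter_not, Finset.mul_sum]
    conv_lhs => rw [P.as_sum]
    refine Finset.sum_congr rfl fun e he => ?_
    rw [monomial_mul, one_mul, add_tsub_cancel_of_le (hρ e he)]
  -- `P₀⁰ ≠ 0`
  obtain ⟨e₀, he₀, he₀j⟩ := hlayer
  have hinj : ∀ e ∈ P.support, ∀ e' ∈ P.support, e - ρ = e' - ρ → e = e' := by
    intro e he e' he' h
    have := congrArg (· + ρ) h
    simpa only [tsub_add_cancel_of_le (hρ e he), tsub_add_cancel_of_le (hρ e' he')] using this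
  have hcoeffP00 : ∀ e ∈ L, coeff (e - ρ) P00 = coeff e P := by
    intro e he
    rw [hP00, coeff_sum]
    rw [Finset.sum_eq_single e]
    · simp
    · intro e' he' hne
      rw [coeff_monomial, if_neg]
      intro h
      exact hne (hinj e' (Finset.mem_filter.mp he').1 e (Finset.mem_filter.mp he).1 h)
    · intro h; exact (h he).elim
  have he₀L : e₀ ∈ L := Finset.mem_filter.mpr ⟨he₀, he₀j⟩
  have hP00ne : P00 ≠ 0 := by
    intro h
    have := hcoeffP00 e₀ he₀L
    rw [h, coeff_zero] at this
    exact (MvPolynomial.mem_support_iff.mp he₀) this.symm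
  -- every monomial of `translate b P₀⁰` has `j`-exponent `0` and degree `≤ D`
  have hsuppP00 : ∀ β ∈ P00.support, ∃ e ∈ L, β = e - ρ := by
    intro β hβ
    by_contra hc
    push Not at hc
    rw [MvPolynomial.mem_support_iff, hP00, coeff_sum] at hβ
    exact hβ (Finset.sum_eq_zero fun e he => by rw [coeff_monomial, if_neg (fun h => hc e he h.symm)])
  have hT00 : ∀ β ∈ (translate b P00).support, β j = 0 ∧ β.degree ≤ D := by
    intro β hβ
    rw [MvPolynomial.mem_support_iff, translate_eq_sum_support, coeff_sum] at hβ
    obtain ⟨γ, hγ, hγne⟩ := Finset.exists_ne_zero_of_sum_ne_zero hβ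
    obtain ⟨e, he, rfl⟩ := hsuppP00 γ hγ
    have heP : e ∈ P.support := (Finset.mem_filter.mp he).1
    have hej : e j = ρ j := (Finset.mem_filter.mp he).2
    refine ⟨?_, ?_⟩
    · rw [apply_eq_of_coeff_translate_monomial_ne_zero b hbj hγne, Finsupp.tsub_apply, hej,
        Nat.sub_self]
    · have h1 := degree_le_degree_of_le (le_of_coeff_translate_monomial_ne_zero b hγne)
      have h2 : (e - ρ).degree + ρ.degree = e.degree := by
        rw [← map_add, tsub_add_cancel_of_le (hρ e heP)]
      have h3 := hD e heP hej
      omega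
  -- the translated rest lives in the layers `> 0`
  have hT0p : ∀ δ : σ →₀ ℕ, δ j = 0 → coeff δ (translate b P0p) = 0 := by
    intro δ hδ
    rw [translate_eq_sum_support, coeff_sum]
    refine Finset.sum_eq_zero fun γ hγ => ?_
    by_contra hne
    have hγsupp : ∃ e ∈ P.support, ¬ e j = ρ j ∧ γ = e - ρ := by
      by_contra hc
      push Not at hc
      rw [MvPolynomial.mem_support_iff, hP0p, coeff_sum] at hγ
      exact hγ (Finset.sum_eq_zero fun e he => by
        rw [coeff_monomial, if_neg]
        intro h
        exact hc e (Finset.mem_filter.mp he).1 (Finset.mem_filter.mp he).2 h.symm)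
    obtain ⟨e, he, hej, rfl⟩ := hγsupp
    have h1 := apply_eq_of_coeff_translate_monomial_ne_zero b hbj hne
    rw [hδ, Finsupp.tsub_apply] at h1
    have h2 : ρ j ≤ e j := Finsupp.le_def.mp (hρ e he) j
    omega
  -- choose `β` of minimal degree in the support of `translate b P₀⁰`
  have hTne : (translate b P00).support.Nonempty :=
    MvPolynomial.support_nonempty.mpr (translate_ne_zero b hP00ne)
  obtain ⟨β, hβ, hβmin⟩ := Finset.exists_min_image _ (fun β : σ →₀ ℕ => β.degree) hTne
  obtain ⟨hβj, hβD⟩ := hT00 β hβ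
  have hQ : ∀ δ : σ →₀ ℕ, δ j = 0 →
      coeff δ (translate b (P00 + P0p)) = coeff δ (translate b P00) := by
    intro δ hδ
    rw [show translate b (P00 + P0p) = translate b P00 + translate b P0p from map_add _ _ _,
      coeff_add, hT0p δ hδ, add_zero]
  have hmin : ∀ δ : σ →₀ ℕ, δ j = 0 → δ.degree < β.degree →
      coeff δ (translate b (P00 + P0p)) = 0 := by
    intro δ hδ hlt
    rw [hQ δ hδ]
    by_contra hne
    exact absurd (hβmin δ (MvPolynomial.mem_support_iff.mpr hne)) (not_le.mpr hlt)
  -- the exponent `E = β + ρ_Z`, `Z = {b = 0}`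
  set ρZ : σ →₀ ℕ := ρ.filter fun i => b i = 0 with hρZ
  refine ⟨β + ρZ, ?_, ?_, ?_⟩
  · rw [MvPolynomial.mem_support_iff, hPfac,
      show translate b (monomial ρ 1 * (P00 + P0p)) =
        translate b (monomial ρ 1) * translate b (P00 + P0p) from map_mul _ _ _,
      coeff_mul]
    rw [Finset.sum_eq_single (ρZ, β)]
    · -- the surviving term
      rw [coeff_translate_monomial, one_mul, hQ β hβj]
      refine mul_ne_zero ?_ (MvPolynomial.mem_support_iff.mp hβ)
      rw [Finset.prod_ne_zero_iff]
      intro i _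
      by_cases hbi : b i = 0
      · have : ρZ i = ρ i := by rw [hρZ, Finsupp.filter_apply, if_pos hbi]
        rw [this, Nat.choose_self, Nat.sub_self, pow_zero, mul_one, Nat.cast_one]
        exact one_ne_zero
      · have : ρZ i = 0 := by rw [hρZ, Finsupp.filter_apply, if_neg hbi]
        rw [this, Nat.choose_zero_right, Nat.sub_zero, Nat.cast_one, one_mul]
        exact pow_ne_zero _ hbi
    · -- all other terms vanish
      rintro ⟨γ, δ⟩ hx hne
      rw [Finset.mem_antidiagonal] at hx
      by_cases hγ0 : coeff γ (translate b (monomial ρ (1 : K))) = 0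
      · rw [hγ0, zero_mul]
      have hγle : γ ≤ ρ := le_of_coeff_translate_monomial_ne_zero b hγ0
      have hγZ : ∀ i, b i = 0 → γ i = ρ i := fun i hbi =>
        apply_eq_of_coeff_translate_monomial_ne_zero b hbi hγ0
      have hρZγ : ρZ ≤ γ := by
        rw [Finsupp.le_def]
        intro i
        by_cases hbi : b i = 0
        · rw [hρZ, Finsupp.filter_apply, if_pos hbi, hγZ i hbi]
        · rw [hρZ, Finsupp.filter_apply, if_neg hbi]; exact Nat.zero_le _
      have hδle : δ ≤ β := by
        rw [Finsupp.le_def]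
        intro i
        have h1 := DFunLike.congr_fun hx i
        simp only [Finsupp.coe_add, Pi.add_apply] at h1
        have h2 := Finsupp.le_def.mp hρZγ i
        omega
      have hδj : δ j = 0 := by
        have := Finsupp.le_def.mp hδle j
        omega
      rcases hδle.lt_or_eq with hlt | heq
      · rw [hmin δ hδj (degree_lt_degree_of_lt hlt), mul_zero]
      · exfalso
        apply hne
        subst heq
        have h' : γ + δ = ρZ + δ := by rw [hx, add_comm]
        rw [add_right_cancel h']
    · intro h
      exact (h (Finset.mem_antidiagonal.mpr (add_comm _ _))).elim
  · simp only [Finsupp.coe_add, Pi.add_apply, hβj, zero_add, hρZ, Finsupp.filter_apply,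
      if_pos hbj]
  · rw [map_add]
    omega

end Translate


/-! ## 5. The two probes and Moh's bound -/

section Main

variable {σ : Type*} {K : Type*} [Field K] [Fintype σ] [DecidableEq σ] [DecidableEq K]
variable (p : ℕ) [hp : Fact p.Prime] [CharP K p]

omit [Fintype σ] [DecidableEq K] hp [CharP K p] in
/-- The polynomial seen at the point `b` of the `y_j`-chart, termwise. [folklore] -/
theorem pointTransform_eq_sum (q : ℕ) (j : σ) (b : σ → K) (s : State σ K) :
    pointTransform q j b s =
      ∑ d ∈ s.F.support, translate b (monomial (chartExponent q j d) (coeff d s.F)) := by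
  unfold pointTransform chartTransform translate
  rw [map_sum]

omit [Fintype σ] [DecidableEq σ] [DecidableEq K] hp [CharP K p] in
/-- A monomial of the new residual polynomial of low degree bounds the new shade. [folklore] -/
theorem shade_le_of_mem_support (t : State σ K) {E : σ →₀ ℕ} (hE : E ∈ t.F.support) {m : ℕ}
    (hm : E.degree ≤ t.r.degree + m) : t.shade ≤ m := by
  unfold State.shade
  have h1 : ordZero t.F ≤ (E.degree : ℕ∞) :=
    ordZero_le_of_coeff_ne_zero _ _ (MvPolynomial.mem_support_iff.mp hE)
  calc ordZero t.F - (t.r.degree : ℕ∞)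
      ≤ (E.degree : ℕ∞) - (t.r.degree : ℕ∞) := tsub_le_tsub_right h1 _
    _ = ((E.degree - t.r.degree : ℕ) : ℕ∞) := (ENat.coe_sub _ _).symm
    _ ≤ m := by exact_mod_cast (by omega : E.degree - t.r.degree ≤ m)

omit [Fintype σ] [DecidableEq σ] [DecidableEq K] hp [CharP K p] in
/-- The natural-number order of a state: all monomials have degree `≥ o`. [folklore] -/
theorem le_degree_of_ordZero_eq (s : State σ K) {o : ℕ} (ho : ordZero s.F = o) :
    ∀ d ∈ s.F.support, o ≤ d.degree := by
  intro d hd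
  obtain ⟨-, hmin⟩ := (ordZero_eq_nat_iff _ _).mp ho
  by_contra h
  exact (MvPolynomial.mem_support_iff.mp hd) (hmin d (not_le.mp h))

omit [Fintype σ] hp [CharP K p] in
/-- The new multiplicities, rewritten: `r' = (r.update j (o − q)).filter {b = 0}`. [folklore] -/
theorem newMult_eq (q : ℕ) (j : σ) (b : σ → K) (hbj : b j = 0) (s : State σ K) {o : ℕ}
    (ho : ordZero s.F = o) :
    newMult q j b s = (s.r.update j (o - q)).filter (fun i => b i = 0) := by
  unfold newMult
  rw [filter_update_of_pos s.r (Z := fun i => b i = 0) hbj, ho, ENat.toNat_coe]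

omit hp [CharP K p] in
/-- **Probe 1 (`p ∤ ord₀ F`): no increase.** If the order `o` of the residual polynomial is
prime to `p`, the lowest `y_j`-layer of the translated chart transform contains a monomial
`y^E` with `E_j = o − p ≢ 0 (mod p)` — hence surviving the cleaning — of degree at most
`|r'| + shade`. [cite: Moh1987, §1 (proof of the Stability Theorem, Possibility (II))] -/
theorem exists_support_step_of_not_dvd (j : σ) (b : σ → K) (hbj : b j = 0) (s : State σ K)
    {o : ℕ} (ho : ordZero s.F = o) (hpo : p ≤ o) (hr : ∀ d ∈ s.F.support, s.r ≤ d)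
    (hndvd : ¬ p ∣ o) :
    ∃ E ∈ (step p j b s).F.support,
      E.degree ≤ (step p j b s).r.degree + (o - s.r.degree) := by
  obtain ⟨⟨d₀, hd₀, hd₀deg⟩, -⟩ := (ordZero_eq_nat_iff _ _).mp ho
  have hdeg := le_degree_of_ordZero_eq s ho
  have hd₀s : d₀ ∈ s.F.support := MvPolynomial.mem_support_iff.mpr hd₀
  set ρ : σ →₀ ℕ := s.r.update j (o - p) with hρdef
  have hρj : ρ j = o - p := by rw [hρdef, Finsupp.update_apply, if_pos rfl]
  have hρi : ∀ i, i ≠ j → ρ i = s.r i := fun i hi => by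
    rw [hρdef, Finsupp.update_apply, if_neg hi]
  have hsupp : ∀ e ∈ (chartTransform p j s.F).support,
      ∃ d ∈ s.F.support, chartExponent p j d = e := by
    intro e he
    unfold chartTransform at he
    obtain ⟨d, hd, -, hde⟩ := exists_of_mem_support_sum_monomial _ _ _ he
    exact ⟨d, hd, hde⟩
  have hρle : ∀ e ∈ (chartTransform p j s.F).support, ρ ≤ e := by
    intro e he
    obtain ⟨d, hd, rfl⟩ := hsupp e he
    rw [Finsupp.le_def]
    intro i
    rw [chartExponent_apply]
    by_cases hij : i = j
    · subst hij
      rw [if_pos rfl, hρj]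
      have := hdeg d hd
      omega
    · rw [if_neg hij, hρi i hij]
      exact Finsupp.le_def.mp (hr d hd) i
  have hD : ∀ e ∈ (chartTransform p j s.F).support, e j = ρ j →
      e.degree ≤ ρ.degree + (o - s.r.degree) := by
    intro e he hej
    obtain ⟨d, hd, rfl⟩ := hsupp e he
    rw [chartExponent_apply, if_pos rfl, hρj] at hej
    have h1 := hdeg d hd
    have h2 : d.degree = o := by omega
    rw [degree_chartExponent, h2]
    have h3 := degree_update_add s.r j (o - p)
    rw [← hρdef] at h3
    have h4 : s.r j ≤ d j := Finsupp.le_def.mp (hr d hd) j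
    have h5 : d j ≤ o := h2 ▸ Finsupp.le_degree j d
    have h6 : s.r j ≤ s.r.degree := Finsupp.le_degree j s.r
    omega
  have hlayer : ∃ e ∈ (chartTransform p j s.F).support, e j = ρ j := by
    refine ⟨chartExponent p j d₀, ?_, ?_⟩
    · rw [MvPolynomial.mem_support_iff]
      unfold chartTransform
      rw [coeff_sum_monomial_of_injOn s.F.support (chartExponent p j) (fun d => coeff d s.F) hd₀s]
      · exact hd₀
      · intro d hd _ h
        exact chartExponent_injective (le_trans hpo (hdeg d hd)) (le_trans hpo (hdeg d₀ hd₀s)) h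
    · rw [chartExponent_apply, if_pos rfl, hd₀deg, hρj]
  obtain ⟨E, hE, hEj, hEdeg⟩ :=
    exists_mem_support_translate_layer b hbj (chartTransform p j s.F) ρ hρle (o - s.r.degree)
      hD hlayer
  have hEj' : E j = o - p := by rw [hEj, hρj]
  have hnot : ¬ IsPthPowerExponent p E := by
    intro h
    have h1 : p ∣ E j := (isPthPowerExponent_iff p E).mp h j
    rw [hEj'] at h1
    apply hndvd
    have : o = (o - p) + p := by omega
    rw [this]
    exact dvd_add h1 (dvd_refl p)
  refine ⟨E, ?_, ?_⟩
  · show E ∈ (deletePthPowers p (pointTransform p j b s)).support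
    rw [MvPolynomial.mem_support_iff, coeff_deletePthPowers, if_neg hnot]
    exact MvPolynomial.mem_support_iff.mp hE
  · have hr1 : (step p j b s).r = ρ.filter (fun i => b i = 0) := by
      show newMult p j b s = _
      rw [newMult_eq p j b hbj s ho, hρdef]
    rw [hr1]
    exact hEdeg

/-- **Probe 2 (`∂/∂y_{i₀}`): increase at most one.** If some initial monomial `y^{d₀}` of
`F` (`|d₀| = ord₀ F`) has `p ∤ (d₀)_{i₀}` for an index `i₀ ≠ j`, then — since `∂/∂y_{i₀}`
commutes with the translation and (up to the shift by `y_j`) with the chart transform, and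
kills `p`-th powers — the derivative `∂G/∂y_{i₀}` of the translated chart transform `G` has a
monomial in its lowest `y_j`-layer of controlled degree, and `y_{i₀}` times it is a monomial
of `G` surviving the cleaning. The bound is in terms of `rm = r − e_{i₀}` (truncated).
[cite: Moh1987, §1 (Propositions 1–2 and Possibilities (III)–(IV) of the proof)] -/
theorem exists_support_step_of_not_dvd_apply' (j : σ) (b : σ → K) (hbj : b j = 0)
    (s : State σ K) {o : ℕ} (ho : ordZero s.F = o) (hpo : p ≤ o)
    (hr : ∀ d ∈ s.F.support, s.r ≤ d) {i₀ : σ} (hi₀ : i₀ ≠ j) {d₀ : σ →₀ ℕ}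
    (hd₀ : d₀ ∈ s.F.support) (hd₀deg : d₀.degree = o) (hd₀i : ¬ p ∣ d₀ i₀) :
    ∃ E ∈ (step p j b s).F.support, ¬ p ∣ E i₀ ∧ E j = o - p ∧
      E.degree ≤ (((s.r - Finsupp.single i₀ 1).update j (o - p)).filter (fun i => b i = 0)).degree
        + (o - 1 - (s.r - Finsupp.single i₀ 1).degree) + 1 := by
  have hdeg := le_degree_of_ordZero_eq s ho
  have hp1 : 1 < p := hp.out.one_lt
  set rm : σ →₀ ℕ := s.r - Finsupp.single i₀ 1 with hrmdef
  have hrmi₀ : rm i₀ = s.r i₀ - 1 := by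
    rw [hrmdef, Finsupp.tsub_apply, Finsupp.single_eq_same]
  have hrmi : ∀ i, i ≠ i₀ → rm i = s.r i := fun i hi => by
    rw [hrmdef, Finsupp.tsub_apply, Finsupp.single_apply, if_neg (Ne.symm hi), Nat.sub_zero]
  have hrmle : ∀ i, rm i ≤ s.r i := fun i => by
    rw [hrmdef, Finsupp.tsub_apply]; exact Nat.sub_le _ _
  -- `|rm| + 1 ≤ o`
  have hd₀i1 : 1 ≤ d₀ i₀ := by
    rcases Nat.eq_zero_or_pos (d₀ i₀) with h | h
    · rw [h] at hd₀i; exact (hd₀i (dvd_zero p)).elim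
    · exact h
  have hrmo : rm.degree + 1 ≤ o := by
    by_cases h1 : 1 ≤ s.r i₀
    · have heq : rm + Finsupp.single i₀ 1 = s.r := by
        rw [hrmdef]; exact tsub_add_cancel_of_le (Finsupp.single_le_iff.mpr h1)
      have h2 : s.r.degree ≤ d₀.degree := degree_le_degree_of_le (hr d₀ hd₀)
      have h3 : (rm + Finsupp.single i₀ 1).degree = rm.degree + 1 := by
        rw [map_add, Finsupp.degree_single]
      rw [heq] at h3
      omega
    · have h0 : s.r i₀ = 0 := by omega
      have heq : rm = s.r := by
        ext i
        by_cases hi : i = i₀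
        · subst hi; rw [hrmi₀, h0]
        · exact hrmi i hi
      have hne : s.r ≠ d₀ := by
        intro h; rw [← h, h0] at hd₀i1; exact absurd hd₀i1 (by omega)
      have hlt : s.r < d₀ := lt_of_le_of_ne (hr d₀ hd₀) hne
      have := degree_lt_degree_of_lt hlt
      rw [heq]; omega
  set ρ : σ →₀ ℕ := rm.update j (o - p) with hρdef
  have hρj : ρ j = o - p := by rw [hρdef, Finsupp.update_apply, if_pos rfl]
  have hρi : ∀ i, i ≠ j → ρ i = rm i := fun i hi => by
    rw [hρdef, Finsupp.update_apply, if_neg hi]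
  -- the probe polynomial
  set G : MvPolynomial σ K := pointTransform p j b s with hGdef
  set f : (σ →₀ ℕ) → (σ →₀ ℕ) := fun d => chartExponent p j d - Finsupp.single i₀ 1 with hfdef
  set g : (σ →₀ ℕ) → K := fun d => coeff d s.F * (chartExponent p j d i₀ : K) with hgdef
  set Pt : MvPolynomial σ K := ∑ d ∈ s.F.support, monomial (f d) (g d) with hPt
  have hderiv : pderiv i₀ G = translate b Pt := by
    rw [hGdef, pointTransform_eq_sum, map_sum, hPt]
    unfold translate
    rw [map_sum]
    refine Finset.sum_congr rfl fun d _ => ?_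
    have := pderiv_translate b i₀ (monomial (chartExponent p j d) (coeff d s.F))
    unfold translate at this
    rw [this, pderiv_monomial]
  have hchi₀ : ∀ d : σ →₀ ℕ, chartExponent p j d i₀ = d i₀ := fun d => by
    rw [chartExponent_apply, if_neg hi₀]
  -- the terms with non-zero coefficient have `d i₀ ≥ 1`
  have hgi₀ : ∀ d, g d ≠ 0 → 1 ≤ d i₀ := by
    intro d hgd
    rcases Nat.eq_zero_or_pos (d i₀) with h | h
    · exfalso; apply hgd
      rw [hgdef]; simp only [hchi₀ d, h, Nat.cast_zero, mul_zero]
    · exact h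
  have hsingle_le : ∀ d : σ →₀ ℕ, 1 ≤ d i₀ → Finsupp.single i₀ 1 ≤ chartExponent p j d := by
    intro d hd
    rw [Finsupp.single_le_iff, hchi₀ d]
    exact hd
  have hsuppPt : ∀ e ∈ Pt.support, ∃ d ∈ s.F.support, g d ≠ 0 ∧ f d = e := fun e he =>
    exists_of_mem_support_sum_monomial _ _ _ he
  -- pointwise description of `f d`
  have hfj : ∀ d : σ →₀ ℕ, f d j = d.degree - p := fun d => by
    rw [hfdef]
    simp only [Finsupp.tsub_apply, chartExponent_apply, if_true, Finsupp.single_apply,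
      if_neg hi₀, Nat.sub_zero]
  have hfi₀ : ∀ d : σ →₀ ℕ, f d i₀ = d i₀ - 1 := fun d => by
    rw [hfdef]
    simp only [Finsupp.tsub_apply, hchi₀ d, Finsupp.single_eq_same]
  have hfi : ∀ d : σ →₀ ℕ, ∀ i, i ≠ j → i ≠ i₀ → f d i = d i := fun d i hij hii₀ => by
    rw [hfdef]
    simp only [Finsupp.tsub_apply, chartExponent_apply, if_neg hij, Finsupp.single_apply,
      if_neg (Ne.symm hii₀), Nat.sub_zero]
  have hfdeg : ∀ d : σ →₀ ℕ, 1 ≤ d i₀ →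
      (f d).degree + 1 = (d.degree - p) + (d.degree - d j) := by
    intro d hd
    have h1 : f d + Finsupp.single i₀ 1 = chartExponent p j d := by
      rw [hfdef]; exact tsub_add_cancel_of_le (hsingle_le d hd)
    have h2 := congrArg Finsupp.degree h1
    rw [map_add, Finsupp.degree_single, degree_chartExponent] at h2
    exact h2
  have hρle : ∀ e ∈ Pt.support, ρ ≤ e := by
    intro e he
    obtain ⟨d, hd, hgd, rfl⟩ := hsuppPt e he
    have hd1 := hgi₀ d hgd
    have hrd : ∀ i, s.r i ≤ d i := fun i => Finsupp.le_def.mp (hr d hd) i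
    rw [Finsupp.le_def]
    intro i
    by_cases hij : i = j
    · subst hij
      rw [hρj, hfj]
      have := hdeg d hd
      omega
    · by_cases hii₀ : i = i₀
      · subst hii₀
        rw [hρi i hij, hrmi₀, hfi₀]
        have := hrd i
        omega
      · rw [hρi i hij, hrmi i hii₀, hfi d i hij hii₀]
        exact hrd i
  have hD : ∀ e ∈ Pt.support, e j = ρ j → e.degree ≤ ρ.degree + (o - 1 - rm.degree) := by
    intro e he hej
    obtain ⟨d, hd, hgd, rfl⟩ := hsuppPt e he
    have hd1 := hgi₀ d hgd
    rw [hfj, hρj] at hej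
    have h1 := hdeg d hd
    have h2 : d.degree = o := by omega
    have h3 := hfdeg d hd1
    rw [h2] at h3
    have h4 := degree_update_add rm j (o - p)
    rw [← hρdef, hrmi j (Ne.symm hi₀)] at h4
    have h5 : s.r j ≤ d j := Finsupp.le_def.mp (hr d hd) j
    have h6 : d i₀ ≤ d.degree - d j := apply_le_degree_sub hi₀ d
    rw [h2] at h6
    have h7 : s.r j ≤ s.r.degree := Finsupp.le_degree j s.r
    have h8 : rm.degree ≤ s.r.degree := degree_le_degree_of_le (Finsupp.le_def.mpr hrmle)
    omega
  have hgd₀ : g d₀ ≠ 0 := by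
    rw [hgdef]
    refine mul_ne_zero (MvPolynomial.mem_support_iff.mp hd₀) ?_
    rw [hchi₀ d₀, Ne, CharP.cast_eq_zero_iff K p]
    exact hd₀i
  have hlayer : ∃ e ∈ Pt.support, e j = ρ j := by
    refine ⟨f d₀, ?_, ?_⟩
    · rw [MvPolynomial.mem_support_iff, hPt, coeff_sum_monomial_of_injOn s.F.support f g hd₀]
      · exact hgd₀
      · intro d hd hgd h
        have hd1 := hgi₀ d hgd
        have h' : chartExponent p j d = chartExponent p j d₀ :=
          (tsub_left_inj (hsingle_le d hd1) (hsingle_le d₀ hd₀i1)).mp h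
        exact chartExponent_injective (le_trans hpo (hdeg d hd))
          (le_trans hpo (hd₀deg ▸ le_refl _)) h'
    · rw [hfj, hd₀deg, hρj]
  obtain ⟨E', hE', hE'j, hE'deg⟩ :=
    exists_mem_support_translate_layer b hbj Pt ρ hρle (o - 1 - rm.degree) hD hlayer
  -- `E' + e_{i₀}` is a monomial of `G` surviving the cleaning
  rw [← hderiv, MvPolynomial.mem_support_iff, coeff_pderiv] at hE'
  have hcoeff : coeff (E' + Finsupp.single i₀ 1) G ≠ 0 := fun h => hE' (by rw [h, zero_mul])
  have hcast : ((E' i₀ : K) + 1) ≠ 0 := fun h => hE' (by rw [h, mul_zero])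
  set E : σ →₀ ℕ := E' + Finsupp.single i₀ 1 with hEdef
  have hEi₀ : E i₀ = E' i₀ + 1 := by
    rw [hEdef, Finsupp.add_apply, Finsupp.single_eq_same]
  have hnoti₀ : ¬ p ∣ E i₀ := by
    intro h1
    rw [hEi₀, ← CharP.cast_eq_zero_iff K p, Nat.cast_succ] at h1
    exact hcast h1
  have hnot : ¬ IsPthPowerExponent p E := fun h =>
    hnoti₀ ((isPthPowerExponent_iff p E).mp h i₀)
  have hEj : E j = o - p := by
    rw [hEdef, Finsupp.add_apply, Finsupp.single_apply, if_neg hi₀, add_zero, hE'j, hρj]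
  refine ⟨E, ?_, hnoti₀, hEj, ?_⟩
  · show E ∈ (deletePthPowers p (pointTransform p j b s)).support
    rw [MvPolynomial.mem_support_iff, coeff_deletePthPowers, if_neg hnot]
    exact hcoeff
  · have hEdeg : E.degree = E'.degree + 1 := by
      rw [hEdef, map_add, Finsupp.degree_single]
    rw [hEdeg]
    omega

/-- Probe 2, degree bound only (the form used by `mohBound_one`).
[cite: Moh1987, §1 (Propositions 1–2 and Possibilities (III)–(IV) of the proof)] -/
theorem exists_support_step_of_not_dvd_apply (j : σ) (b : σ → K) (hbj : b j = 0)
    (s : State σ K) {o : ℕ} (ho : ordZero s.F = o) (hpo : p ≤ o)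
    (hr : ∀ d ∈ s.F.support, s.r ≤ d) {i₀ : σ} (hi₀ : i₀ ≠ j) {d₀ : σ →₀ ℕ}
    (hd₀ : d₀ ∈ s.F.support) (hd₀deg : d₀.degree = o) (hd₀i : ¬ p ∣ d₀ i₀) :
    ∃ E ∈ (step p j b s).F.support,
      E.degree ≤ (((s.r - Finsupp.single i₀ 1).update j (o - p)).filter (fun i => b i = 0)).degree
        + (o - 1 - (s.r - Finsupp.single i₀ 1).degree) + 1 := by
  obtain ⟨E, hE, -, -, hdeg⟩ :=
    exists_support_step_of_not_dvd_apply' p j b hbj s ho hpo hr hi₀ hd₀ hd₀deg hd₀i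
  exact ⟨E, hE, hdeg⟩

omit hp in
/-- In characteristic `p`, a monomial of degree divisible by `p` which is not a `p`-th power
has an exponent prime to `p` at some index OTHER than any given `j`. [folklore] -/
theorem exists_ne_not_dvd (j : σ) {d : σ →₀ ℕ} (hdvd : p ∣ d.degree)
    (hnp : ¬ IsPthPowerExponent p d) : ∃ i, i ≠ j ∧ ¬ p ∣ d i := by
  by_contra hc
  push Not at hc
  apply hnp
  rw [isPthPowerExponent_iff]
  intro i
  by_cases hij : i = j
  · subst hij
    rw [degree_eq_add_sum_erase i d] at hdvd
    have hsum : p ∣ ∑ k ∈ univ.erase i, d k :=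
      Finset.dvd_sum fun k hk => hc k (Finset.ne_of_mem_erase hk)
    exact (Nat.dvd_add_left hsum).mp hdvd
  · exact hc i hij

omit [Fintype σ] [DecidableEq K] hp [CharP K p] in
/-- Cleanness as a support condition. [folklore] -/
theorem not_isPthPowerExponent_of_clean (q : ℕ) {F : MvPolynomial σ K}
    (hclean : deletePthPowers q F = F) {d : σ →₀ ℕ} (hd : d ∈ F.support) :
    ¬ IsPthPowerExponent q d := by
  intro h
  have := MvPolynomial.mem_support_iff.mp hd
  rw [← hclean, coeff_deletePthPowers, if_pos h] at this
  exact this rfl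

/-! ### The arithmetic of the three sub-cases of Probe 2 -/

omit [Fintype σ] hp [CharP K p] in
/-- Sub-case `r_{i₀} = 0` (a non-exceptional direction): the bound of Probe 2 is
`|r'| + shade`. [folklore] -/
theorem probe_bound_of_apply_eq_zero (j : σ) (b : σ → K) (hbj : b j = 0) (s : State σ K)
    {o q : ℕ} (ho : ordZero s.F = o) {i₀ : σ} (hri₀ : s.r i₀ = 0)
    (hro : s.r.degree + 1 ≤ o) :
    (((s.r - Finsupp.single i₀ 1).update j (o - q)).filter (fun i => b i = 0)).degree
        + (o - 1 - (s.r - Finsupp.single i₀ 1).degree) + 1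
      = (newMult q j b s).degree + (o - s.r.degree) := by
  have heq : s.r - Finsupp.single i₀ 1 = s.r := by
    ext i
    rw [Finsupp.tsub_apply, Finsupp.single_apply]
    by_cases hi : i₀ = i
    · subst hi; rw [if_pos rfl, hri₀]
    · rw [if_neg hi, Nat.sub_zero]
  rw [heq, newMult_eq q j b hbj s ho]
  omega

omit [Fintype σ] hp [CharP K p] in
/-- Sub-case `b_{i₀} = 0`, `r_{i₀} ≥ 1` (an exceptional component through the new point):
the bound of Probe 2 is again `|r'| + shade`. [folklore] -/
theorem probe_bound_of_translate_eq_zero (j : σ) (b : σ → K) (hbj : b j = 0) (s : State σ K)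
    {o q : ℕ} (ho : ordZero s.F = o) {i₀ : σ} (hi₀ : i₀ ≠ j) (hbi₀ : b i₀ = 0)
    (hri₀ : 1 ≤ s.r i₀) (hro : s.r.degree ≤ o) :
    (((s.r - Finsupp.single i₀ 1).update j (o - q)).filter (fun i => b i = 0)).degree
        + (o - 1 - (s.r - Finsupp.single i₀ 1).degree) + 1
      = (newMult q j b s).degree + (o - s.r.degree) := by
  have h1 : (s.r - Finsupp.single i₀ 1) + Finsupp.single i₀ 1 = s.r :=
    tsub_add_cancel_of_le (Finsupp.single_le_iff.mpr hri₀)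
  have h1d : (s.r - Finsupp.single i₀ 1).degree + 1 = s.r.degree := by
    have := congrArg Finsupp.degree h1
    rwa [map_add, Finsupp.degree_single] at this
  have h2 : ((s.r - Finsupp.single i₀ 1).update j (o - q)).filter (fun i => b i = 0)
      + Finsupp.single i₀ 1 = (s.r.update j (o - q)).filter (fun i => b i = 0) := by
    ext i
    simp only [Finsupp.add_apply, Finsupp.filter_apply, Finsupp.update_apply,
      Finsupp.tsub_apply, Finsupp.single_apply]
    by_cases hij : i = j
    · subst hij; simp [hbj, hi₀]
    · by_cases hii : i₀ = i
      · subst hii; simp [hij, hbi₀]; omega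
      · simp [hij, hii]
  have h2d := congrArg Finsupp.degree h2
  rw [map_add, Finsupp.degree_single, ← newMult_eq q j b hbj s ho] at h2d
  omega

omit hp [CharP K p] in
/-- General sub-case: the bound of Probe 2 is at most `|r'| + shade + 1`. [folklore] -/
theorem probe_bound_le (j : σ) (b : σ → K) (hbj : b j = 0) (s : State σ K)
    {o q : ℕ} (ho : ordZero s.F = o) (i₀ : σ) :
    (((s.r - Finsupp.single i₀ 1).update j (o - q)).filter (fun i => b i = 0)).degree
        + (o - 1 - (s.r - Finsupp.single i₀ 1).degree) + 1
      ≤ (newMult q j b s).degree + (o - s.r.degree) + 1 := by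
  have h1 : ((s.r - Finsupp.single i₀ 1).update j (o - q)).filter (fun i => b i = 0)
      ≤ (s.r.update j (o - q)).filter (fun i => b i = 0) := by
    rw [Finsupp.le_def]
    intro i
    simp only [Finsupp.filter_apply, Finsupp.update_apply, Finsupp.tsub_apply]
    split_ifs <;> omega
  have h1d := degree_le_degree_of_le h1
  rw [← newMult_eq q j b hbj s ho] at h1d
  have h2 : s.r ≤ (s.r - Finsupp.single i₀ 1) + Finsupp.single i₀ 1 := le_tsub_add
  have h2d := degree_le_degree_of_le h2
  rw [map_add, Finsupp.degree_single] at h2d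
  omega

/-! ### The theorems -/

omit [Fintype σ] [DecidableEq σ] [DecidableEq K] hp [CharP K p] in
/-- The shade of a state with non-zero residual polynomial of order `o`. [folklore] -/
theorem shade_eq_of_ordZero_eq (s : State σ K) {o : ℕ} (ho : ordZero s.F = o) :
    s.shade = ((o - s.r.degree : ℕ) : ℕ∞) := by
  unfold State.shade
  rw [ho]
  exact (ENat.coe_sub _ _).symm

omit hp [CharP K p] in
/-- **The shade does not increase when `p ∤ ord₀ F`** (Hauser's condition (1) /
Hauser–Perlega's assertion (2) for `c = p`, contrapositive, in every dimension).
[cite: HauserPerlega2019PRIMS, §3 Theorem (2)] [cite: Hauser2010, §G Kangaroo Theorem (1)] -/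
theorem shade_step_le_of_not_dvd (j : σ) (b : σ → K) (hbj : b j = 0) (s : State σ K)
    {o : ℕ} (ho : ordZero s.F = o) (hpo : p ≤ o) (hr : ∀ d ∈ s.F.support, s.r ≤ d)
    (hndvd : ¬ p ∣ o) : (step p j b s).shade ≤ s.shade := by
  obtain ⟨E, hE, hEdeg⟩ := exists_support_step_of_not_dvd p j b hbj s ho hpo hr hndvd
  rw [shade_eq_of_ordZero_eq s ho]
  exact shade_le_of_mem_support _ hE hEdeg

/-- **The shade does not increase when an initial monomial of `F` has an exponent prime to
`p` at an index `i₀ ≠ j` which is untranslated (`b_{i₀} = 0`) or non-exceptional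
(`r_{i₀} = 0`)** (Hauser–Perlega's assertion (7) for `c = p`, read in fixed coordinates,
contrapositive, in every dimension). [cite: HauserPerlega2019PRIMS, §3 Theorem (7)] -/
theorem shade_step_le_of_not_dvd_apply (j : σ) (b : σ → K) (hbj : b j = 0) (s : State σ K)
    {o : ℕ} (ho : ordZero s.F = o) (hpo : p ≤ o) (hr : ∀ d ∈ s.F.support, s.r ≤ d)
    {i₀ : σ} (hi₀ : i₀ ≠ j) (hfix : b i₀ = 0 ∨ s.r i₀ = 0) {d₀ : σ →₀ ℕ}
    (hd₀ : d₀ ∈ s.F.support) (hd₀deg : d₀.degree = o) (hd₀i : ¬ p ∣ d₀ i₀) :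
    (step p j b s).shade ≤ s.shade := by
  obtain ⟨E, hE, hEdeg⟩ :=
    exists_support_step_of_not_dvd_apply p j b hbj s ho hpo hr hi₀ hd₀ hd₀deg hd₀i
  rw [shade_eq_of_ordZero_eq s ho]
  refine shade_le_of_mem_support _ hE ?_
  have hro : s.r.degree ≤ o := hd₀deg ▸ degree_le_degree_of_le (hr d₀ hd₀)
  rcases Nat.eq_zero_or_pos (s.r i₀) with h0 | h1
  · have hro' : s.r.degree + 1 ≤ o := by
      have hne : s.r ≠ d₀ := by
        intro h; rw [h] at h0; rw [h0] at hd₀i; exact hd₀i (dvd_zero p)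
      have := degree_lt_degree_of_lt (lt_of_le_of_ne (hr d₀ hd₀) hne)
      omega
    rw [probe_bound_of_apply_eq_zero j b hbj s ho h0 hro'] at hEdeg
    exact hEdeg
  · rcases hfix with hb | hr0
    · rw [probe_bound_of_translate_eq_zero j b hbj s ho hi₀ hb h1 hro] at hEdeg
      exact hEdeg
    · omega

/-- **Moh's bound at order `p`, in every dimension.** For a cleaned residual polynomial `F`
of `x^p + F(y₁, …, y_m)` (no `p`-th power monomials), of order `≥ p`, divisible by the
exceptional monomial `y^r`, and ANY point `b` of the exceptional divisor of the blow-up of the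
origin (chart `y_j`, `b_j = 0`; any number `m` of variables, any field of characteristic `p`,
no equimultiplicity hypothesis needed), the shade after the blow-up and the cleaning is at
most the shade before plus one: `MohBound p 1 j b s`, i.e. `shade' ≤ shade + p^{1−1}`.
Moh states the one-blow-up bound `ord F̄ ≤ d + p^{e−1}` for `z^{p^e} + F(x₁,…,x_n)` and all
`n` (here `e = 1`); Hauser–Perlega prove the bound `+ c!/p` for arbitrary ideals of order
`c = m·p^e` in any dimension (here `c = p`: `(p−1)!` in their normalisation `= 1` in
Hauser's); Hauser 2010 §F states it for surfaces. The increase `+1` is attained (Hauser's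
kangaroo point, characteristic `2`, `m = 2`: `Hauser2003_kangarooShadeIncrease`,
`PointBlowup.shade_kangaroo_example`).
[cite: Moh1987, Stability Theorem (one permissible blow-up), §1]
[cite: HauserPerlega2019PRIMS, §3 Theorem (9)] [cite: Hauser2010, §F Proposition] -/
theorem mohBound_one (j : σ) (b : σ → K) (hbj : b j = 0) (s : State σ K)
    (hclean : deletePthPowers p s.F = s.F) (hord : (p : ℕ∞) ≤ ordZero s.F)
    (hr : ∀ d ∈ s.F.support, s.r ≤ d) : MohBound p 1 j b s := by
  unfold MohBound
  rw [pow_one, Nat.sub_self, pow_zero, Nat.cast_one]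
  by_cases hF : s.F = 0
  · have : s.shade = ⊤ := by
      unfold State.shade
      rw [hF, ordZero_zero, ENat.top_sub_coe]
    rw [this, top_add]
    exact le_top
  have hne : ordZero s.F ≠ ⊤ := by
    unfold ordZero
    rw [Ne, MvPowerSeries.order_eq_top_iff, MvPolynomial.coe_eq_zero_iff]
    exact hF
  obtain ⟨o, ho'⟩ := WithTop.ne_top_iff_exists.mp hne
  have ho : ordZero s.F = o := ho'.symm
  have hpo : p ≤ o := by
    rw [ho] at hord
    exact_mod_cast hord
  have hgoal : (step p j b s).shade ≤ ((o - s.r.degree : ℕ) : ℕ∞) + 1 := by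
    by_cases hdvd : p ∣ o
    · obtain ⟨⟨d₀, hd₀, hd₀deg⟩, -⟩ := (ordZero_eq_nat_iff _ _).mp ho
      have hd₀s : d₀ ∈ s.F.support := MvPolynomial.mem_support_iff.mpr hd₀
      obtain ⟨i₀, hi₀, hd₀i⟩ := exists_ne_not_dvd p j (hd₀deg.symm ▸ hdvd)
        (not_isPthPowerExponent_of_clean p hclean hd₀s)
      obtain ⟨E, hE, hEdeg⟩ :=
        exists_support_step_of_not_dvd_apply p j b hbj s ho hpo hr hi₀ hd₀s hd₀deg hd₀i
      have hb := probe_bound_le j b hbj s ho i₀ (q := p)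
      have : E.degree ≤ (step p j b s).r.degree + ((o - s.r.degree) + 1) := by
        show E.degree ≤ (newMult p j b s).degree + _
        omega
      have := shade_le_of_mem_support _ hE this
      exact_mod_cast this
    · have := shade_step_le_of_not_dvd p j b hbj s ho hpo hr hdvd
      rw [shade_eq_of_ordZero_eq s ho] at this
      exact le_trans this (le_self_add)
  rw [shade_eq_of_ordZero_eq s ho]
  exact hgoal

/-- **Necessary conditions for an increase of the shade at order `p`, in every dimension**
(Hauser–Perlega's assertions (2) and (7), and the "lost component" half of (6), for
`c = p`, `ℓ = 0`, read in fixed coordinates): if the shade increases at the point `b` of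
the `y_j`-chart then (i) `p ∣ ord₀ F` (= `|r| + shade`, Hauser's condition (1)); (ii) for
every index `i ≠ j` which is untranslated (`b_i = 0`) or non-exceptional (`r_i = 0`), the
variable `y_i` occurs in the initial form of `F` only with exponents divisible by `p`;
(iii) consequently some EXCEPTIONAL component `{y_i = 0}`, `r_i ≥ 1`, `i ≠ j`, is lost at
`b` (`b_i ≠ 0`) and carries an initial exponent prime to `p` — together with `{y_j = 0}`,
"at least two components of `D` are lost" when `r_j ≥ 1`.
[cite: HauserPerlega2019PRIMS, §3 Theorem (2), (7) and Comment (d)]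
[cite: Hauser2010, §G Kangaroo Theorem (1), (3)] -/
theorem necessary_of_shadeIncreases (j : σ) (b : σ → K) (hbj : b j = 0) (s : State σ K)
    (hclean : deletePthPowers p s.F = s.F) {o : ℕ} (ho : ordZero s.F = o) (hpo : p ≤ o)
    (hr : ∀ d ∈ s.F.support, s.r ≤ d) (hinc : ShadeIncreases p j b s) :
    p ∣ o ∧
    (∀ i, i ≠ j → (b i = 0 ∨ s.r i = 0) → ∀ d ∈ s.F.support, d.degree = o → p ∣ d i) ∧
    (∃ i, i ≠ j ∧ b i ≠ 0 ∧ s.r i ≠ 0 ∧ ∃ d ∈ s.F.support, d.degree = o ∧ ¬ p ∣ d i) := by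
  unfold ShadeIncreases at hinc
  have h1 : p ∣ o := by
    by_contra hndvd
    exact absurd (shade_step_le_of_not_dvd p j b hbj s ho hpo hr hndvd) (not_le.mpr hinc)
  have h2 : ∀ i, i ≠ j → (b i = 0 ∨ s.r i = 0) →
      ∀ d ∈ s.F.support, d.degree = o → p ∣ d i := by
    intro i hij hfix d hd hddeg
    by_contra hndvd
    exact absurd (shade_step_le_of_not_dvd_apply p j b hbj s ho hpo hr hij hfix hd hddeg hndvd)
      (not_le.mpr hinc)
  refine ⟨h1, h2, ?_⟩
  obtain ⟨⟨d₀, hd₀, hd₀deg⟩, -⟩ := (ordZero_eq_nat_iff _ _).mp ho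
  have hd₀s : d₀ ∈ s.F.support := MvPolynomial.mem_support_iff.mpr hd₀
  obtain ⟨i₀, hi₀, hd₀i⟩ := exists_ne_not_dvd p j (hd₀deg.symm ▸ h1)
    (not_isPthPowerExponent_of_clean p hclean hd₀s)
  refine ⟨i₀, hi₀, ?_, ?_, d₀, hd₀s, hd₀deg, hd₀i⟩
  · intro hb; exact hd₀i (h2 i₀ hi₀ (Or.inl hb) d₀ hd₀s hd₀deg)
  · intro hr0; exact hd₀i (h2 i₀ hi₀ (Or.inr hr0) d₀ hd₀s hd₀deg)

/-! ### Persistence of the hypotheses along a sequence of point blow-ups -/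

omit [Fintype σ] [DecidableEq K] hp [CharP K p] in
/-- Cleaning is idempotent: the residual polynomial of a `step` is clean. [folklore] -/
theorem deletePthPowers_deletePthPowers (q : ℕ) (P : MvPolynomial σ K) :
    deletePthPowers q (deletePthPowers q P) = deletePthPowers q P := by
  ext d
  rw [coeff_deletePthPowers, coeff_deletePthPowers]
  split_ifs <;> rfl

omit [Fintype σ] hp [CharP K p] in
/-- The residual polynomial after a step is clean. [folklore] -/
theorem deletePthPowers_step (q : ℕ) (j : σ) (b : σ → K) (s : State σ K) :
    deletePthPowers q (step q j b s).F = (step q j b s).F :=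
  deletePthPowers_deletePthPowers q _

omit hp [CharP K p] in
/-- The new exceptional monomial `y^{r'}` divides the new residual polynomial. [folklore] -/
theorem newMult_le_of_mem_support_step (q : ℕ) (j : σ) (b : σ → K) (hbj : b j = 0)
    (s : State σ K) {o : ℕ} (ho : ordZero s.F = o) (hr : ∀ d ∈ s.F.support, s.r ≤ d) :
    ∀ E ∈ (step q j b s).F.support, (step q j b s).r ≤ E := by
  intro E hE
  have hdeg := le_degree_of_ordZero_eq s ho
  have hE' : coeff E (pointTransform q j b s) ≠ 0 := by
    have h := MvPolynomial.mem_support_iff.mp hE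
    change coeff E (deletePthPowers q (pointTransform q j b s)) ≠ 0 at h
    rw [coeff_deletePthPowers] at h
    split_ifs at h with hP
    · exact (h rfl).elim
    · exact h
  rw [pointTransform_eq_sum, coeff_sum] at hE'
  obtain ⟨d, hd, hne⟩ := Finset.exists_ne_zero_of_sum_ne_zero hE'
  have hle : E ≤ chartExponent q j d := le_of_coeff_translate_monomial_ne_zero b hne
  have hr1 : (step q j b s).r = (s.r.update j (o - q)).filter (fun i => b i = 0) :=
    newMult_eq q j b hbj s ho
  rw [hr1, Finsupp.le_def]
  intro i
  rw [Finsupp.filter_apply, Finsupp.update_apply]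
  by_cases hbi : b i = 0
  · rw [if_pos hbi]
    have heq : E i = chartExponent q j d i := apply_eq_of_coeff_translate_monomial_ne_zero b hbi hne
    rw [heq, chartExponent_apply]
    by_cases hij : i = j
    · rw [if_pos hij, if_pos hij]
      have := hdeg d hd
      omega
    · rw [if_neg hij, if_neg hij]
      exact Finsupp.le_def.mp (hr d hd) i
  · rw [if_neg hbi]
    exact Nat.zero_le _

omit [Fintype σ] hp [CharP K p] in
/-- At an equimultiple point the new residual polynomial has order `≥ q` again. [folklore] -/
theorem le_ordZero_step_of_isEquimultiplePoint (q : ℕ) (j : σ) (b : σ → K) (s : State σ K)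
    (heq : IsEquimultiplePoint q j b s) : (q : ℕ∞) ≤ ordZero (step q j b s).F := by
  refine le_ordZero_of_forall _ q fun d hd => ?_
  by_contra hlt
  apply hd
  change coeff d (deletePthPowers q (pointTransform q j b s)) = 0
  rw [coeff_deletePthPowers]
  split_ifs with hP
  · rfl
  · by_cases hd0 : d = 0
    · exfalso
      apply hP
      rw [hd0, isPthPowerExponent_iff]
      intro i
      exact dvd_zero q
    · exact heq d hd0 (not_le.mp hlt)

/-- **Moh's bound along a sequence of point blow-ups, in every dimension.** Starting from a
cleaned state whose residual polynomial is divisible by its exceptional monomial, along ANY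
sequence of point blow-ups (`s_{n+1} = step p (j n) (b n) s_n`, points `b n` on the new
exceptional divisor, `b n (j n) = 0`) on which the order stays `≥ p` (the equimultiple
branch of the resolution tree), every single step raises the shade by at most one:
`shade(s_{n+1}) ≤ shade(s_n) + 1`. (What is NOT asserted: an eventual bound along the
sequence — Moh's "Stability Theorem" proper — which Hauser–Perlega refute for `e ≥ 3` and
call "known to be valid for `e = 1`"; the tree records that claim nowhere as a theorem.)
[cite: Moh1987, Stability Theorem (one permissible blow-up), §1]
[cite: HauserPerlega2019, §3 ("increase under a single blowup is bounded by p^{e-1}")] -/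
theorem shade_succ_le_along (s : ℕ → State σ K) (j : ℕ → σ) (b : ℕ → σ → K)
    (hb : ∀ n, b n (j n) = 0) (hstep : ∀ n, s (n + 1) = step p (j n) (b n) (s n))
    (hclean : deletePthPowers p (s 0).F = (s 0).F) (hr : ∀ d ∈ (s 0).F.support, (s 0).r ≤ d)
    (hord : ∀ n, (p : ℕ∞) ≤ ordZero (s n).F) (n : ℕ) :
    (s (n + 1)).shade ≤ (s n).shade + 1 := by
  -- the two structural hypotheses persist
  have hinv : ∀ n, deletePthPowers p (s n).F = (s n).F ∧ ∀ d ∈ (s n).F.support, (s n).r ≤ d := by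
    intro n
    induction n with
    | zero => exact ⟨hclean, hr⟩
    | succ n ih =>
      obtain ⟨_, ih2⟩ := ih
      rw [hstep n]
      refine ⟨deletePthPowers_step p (j n) (b n) (s n), ?_⟩
      by_cases hF : (s n).F = 0
      · -- terminal state: the step of the zero polynomial is zero
        intro E hE
        exfalso
        have : (step p (j n) (b n) (s n)).F = 0 := by
          change deletePthPowers p (translate (b n) (chartTransform p (j n) (s n).F)) = 0
          rw [hF]
          unfold chartTransform
          rw [MvPolynomial.support_zero, Finset.sum_empty]
          unfold translate
          rw [map_zero, deletePthPowers_zero]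
        rw [this, MvPolynomial.support_zero] at hE
        exact Finset.notMem_empty _ hE
      · have hne : ordZero (s n).F ≠ ⊤ := by
          unfold ordZero
          rw [Ne, MvPowerSeries.order_eq_top_iff, MvPolynomial.coe_eq_zero_iff]
          exact hF
        obtain ⟨o, ho'⟩ := WithTop.ne_top_iff_exists.mp hne
        exact newMult_le_of_mem_support_step p (j n) (b n) (hb n) (s n) ho'.symm ih2
  obtain ⟨h1, h2⟩ := hinv n
  have hM := mohBound_one p (j n) (b n) (hb n) (s n) h1 (hord n) h2
  unfold MohBound at hM
  rw [pow_one, Nat.sub_self, pow_zero, Nat.cast_one, ← hstep n] at hM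
  exact hM

/-! ### After an increase: the new non-exceptional direction and the next blow-up -/

/-- **Structure after an increase** (Moh's "the interesting thing is that now `x_s` is an
`X`-kind of variable", [Moh87] p. 972): if the shade increases at the point `b` of the
`y_j`-chart, then some exceptional component `{y_{i₀} = 0}` (`r_{i₀} ≥ 1`, `i₀ ≠ j`) is lost at
`b` (`b_{i₀} ≠ 0`), so `y_{i₀}` is NON-exceptional in the new state (`r′_{i₀} = 0`), and the
initial form of the new residual polynomial contains a monomial `y^E` (`|E| = ord₀ F′`) with
`p ∤ E_{i₀}` (Moh's term `A` with `ord_{x_s} A = c`, `p ∤ c`). Every dimension, `e = 1`.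
[cite: Moh1987, §1 (Statement (i)–(iii), p. 972)] -/
theorem exists_nonexceptional_of_shadeIncreases (j : σ) (b : σ → K) (hbj : b j = 0)
    (s : State σ K) (hclean : deletePthPowers p s.F = s.F) {o : ℕ} (ho : ordZero s.F = o)
    (hpo : p ≤ o) (hr : ∀ d ∈ s.F.support, s.r ≤ d) (hinc : ShadeIncreases p j b s) :
    ∃ i₀, i₀ ≠ j ∧ b i₀ ≠ 0 ∧ s.r i₀ ≠ 0 ∧ (step p j b s).r i₀ = 0 ∧
      ∃ o₁ : ℕ, ordZero (step p j b s).F = o₁ ∧ o₁ = (step p j b s).r.degree + (o - s.r.degree) + 1 ∧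
      ∃ E ∈ (step p j b s).F.support, E.degree = o₁ ∧ ¬ p ∣ E i₀ ∧ E j = o - p := by
  obtain ⟨-, -, i₀, hi₀, hbi₀, hri₀, d₀, hd₀, hd₀deg, hd₀i⟩ :=
    necessary_of_shadeIncreases p j b hbj s hclean ho hpo hr hinc
  obtain ⟨E, hE, hEi₀, hEj, hEdeg⟩ :=
    exists_support_step_of_not_dvd_apply' p j b hbj s ho hpo hr hi₀ hd₀ hd₀deg hd₀i
  have hB := probe_bound_le j b hbj s ho i₀ (q := p)
  have hEdeg' : E.degree ≤ (step p j b s).r.degree + (o - s.r.degree) + 1 := by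
    show E.degree ≤ (newMult p j b s).degree + _ + 1
    omega
  -- the new order is a natural number `o₁ ≤ |E|`
  have hF1 : (step p j b s).F ≠ 0 := fun h => by
    rw [h, MvPolynomial.support_zero] at hE; exact Finset.notMem_empty _ hE
  have hne : ordZero (step p j b s).F ≠ ⊤ := by
    unfold ordZero
    rw [Ne, MvPowerSeries.order_eq_top_iff, MvPolynomial.coe_eq_zero_iff]
    exact hF1
  obtain ⟨o₁, ho₁'⟩ := WithTop.ne_top_iff_exists.mp hne
  have ho₁ : ordZero (step p j b s).F = o₁ := ho₁'.symm
  have ho₁E : o₁ ≤ E.degree := by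
    have := ordZero_le_of_coeff_ne_zero _ _ (MvPolynomial.mem_support_iff.mp hE)
    rw [ho₁] at this
    exact_mod_cast this
  -- the increase, in natural numbers
  unfold ShadeIncreases at hinc
  rw [shade_eq_of_ordZero_eq s ho, shade_eq_of_ordZero_eq _ ho₁] at hinc
  have hinc' : o - s.r.degree < o₁ - (step p j b s).r.degree := by exact_mod_cast hinc
  have hr1i₀ : (step p j b s).r i₀ = 0 := by
    show newMult p j b s i₀ = 0
    rw [newMult_eq p j b hbj s ho, Finsupp.filter_apply, if_neg hbi₀]
  refine ⟨i₀, hi₀, hbi₀, hri₀, hr1i₀, o₁, ho₁, by omega, E, hE, by omega, hEi₀, hEj⟩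

/-- **No second increase at the next point blow-up, except possibly in the chart of the lost
component.** After an increase at `(j, b)` there is a lost exceptional component `i₀` (as in
`exists_nonexceptional_of_shadeIncreases`) such that the NEXT point blow-up of the new state, in
ANY chart `j′ ≠ i₀` and at ANY point `b′` of its exceptional divisor where the order has
remained `p`, does not increase the shade (by `shade_step_le_of_not_dvd_apply`: `y_{i₀}` is
non-exceptional and carries an initial exponent prime to `p`). Moh's case "(2) … the order of
`F` will not increase"; his case (1) (the chart of `x_s` itself, where he shows a DROP along the
valuation, without translation) is NOT covered here. Every dimension, `e = 1`.
[cite: Moh1987, §1 (p. 972, cases (1)–(2) after the Statement)]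
[cite: Hauser2010, §F (p. 16, "in the next blowup the shade has to drop at least by 1 (if e = 1)")] -/
theorem shade_step_step_le_of_shadeIncreases (j : σ) (b : σ → K) (hbj : b j = 0)
    (s : State σ K) (hclean : deletePthPowers p s.F = s.F) {o : ℕ} (ho : ordZero s.F = o)
    (hpo : p ≤ o) (hr : ∀ d ∈ s.F.support, s.r ≤ d) (hinc : ShadeIncreases p j b s) :
    ∃ i₀, i₀ ≠ j ∧ b i₀ ≠ 0 ∧ s.r i₀ ≠ 0 ∧
      ∀ (j' : σ) (b' : σ → K), b' j' = 0 → j' ≠ i₀ →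
        (p : ℕ∞) ≤ ordZero (step p j b s).F →
        (step p j' b' (step p j b s)).shade ≤ (step p j b s).shade := by
  obtain ⟨i₀, hi₀, hbi₀, hri₀, hr1i₀, o₁, ho₁, -, E, hE, hEdeg, hEi₀, -⟩ :=
    exists_nonexceptional_of_shadeIncreases p j b hbj s hclean ho hpo hr hinc
  refine ⟨i₀, hi₀, hbi₀, hri₀, fun j' b' hbj' hj' hord => ?_⟩
  have hpo₁ : p ≤ o₁ := by
    rw [ho₁] at hord
    exact_mod_cast hord
  exact shade_step_le_of_not_dvd_apply p j' b' hbj' (step p j b s) ho₁ hpo₁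
    (newMult_le_of_mem_support_step p j b hbj s ho hr) (Ne.symm hj') (Or.inr hr1i₀) hE hEdeg hEi₀

/-- **Two consecutive increases need three special components** (every dimension, `e = 1`).
If the shade increases at `(j, b)` and AGAIN at the next point blow-up `(j′, b′)` of the new
state (order still `p`), then: the second chart `y_{j′}` is an exceptional component lost at
the first step (`b_{j′} ≠ 0`, `r_{j′} ≥ 1`); `p` divides both orders `ord₀ F` and `ord₀ F′`;
and there is a THIRD index `i₁ ∉ {j, j′}`, an exceptional component through the first point
that is NOT lost at the first step (`b_{i₁} = 0`, `r_{i₁} ≥ 1`, so `r′_{i₁} ≥ 1`) but IS lost at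
the second (`b′_{i₁} ≠ 0`). Mechanism: the initial monomial `y^E` of `F′` produced by Probe 2
has `E_j = r′_j = ord₀ F − p ≡ 0`, `E_{j′} ≢ 0 (mod p)`, so `p ∣ |E|` forces a further
exponent `E_{i₁} ≢ 0`, and `shade_step_le_of_not_dvd_apply` at the second step leaves only
lost exceptional components for `i₁`. (Intermediate form; `not_shadeIncreases_step_of_shadeIncreases`
below shows that the hypotheses are in fact contradictory in every dimension.)
[cite: Moh1987, §1 (p. 972, Statement and cases (1)–(2))]
[cite: HauserPerlega2019PRIMS, §3 Theorem (2), (7), Comment (d)] -/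
theorem consecutive_shadeIncreases (j : σ) (b : σ → K) (hbj : b j = 0)
    (s : State σ K) (hclean : deletePthPowers p s.F = s.F) {o : ℕ} (ho : ordZero s.F = o)
    (hpo : p ≤ o) (hr : ∀ d ∈ s.F.support, s.r ≤ d) (hinc : ShadeIncreases p j b s)
    (j' : σ) (b' : σ → K) (hbj' : b' j' = 0) (hord : (p : ℕ∞) ≤ ordZero (step p j b s).F)
    (hinc' : ShadeIncreases p j' b' (step p j b s)) :
    (b j' ≠ 0 ∧ s.r j' ≠ 0 ∧ (step p j b s).r j' = 0) ∧ p ∣ o ∧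
    (∃ o₁ : ℕ, ordZero (step p j b s).F = o₁ ∧ p ∣ o₁) ∧
    ∃ i₁, i₁ ≠ j ∧ i₁ ≠ j' ∧ b i₁ = 0 ∧ s.r i₁ ≠ 0 ∧ (step p j b s).r i₁ ≠ 0 ∧ b' i₁ ≠ 0 := by
  have hpdvd : p ∣ o := (necessary_of_shadeIncreases p j b hbj s hclean ho hpo hr hinc).1
  obtain ⟨i₀, hi₀, hbi₀, hri₀, hr1i₀, o₁, ho₁, -, E, hE, hEdeg, hEi₀, hEj⟩ :=
    exists_nonexceptional_of_shadeIncreases p j b hbj s hclean ho hpo hr hinc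
  have hpo₁ : p ≤ o₁ := by
    rw [ho₁] at hord
    exact_mod_cast hord
  have hclean₁ := deletePthPowers_step p j b s
  have hr₁ := newMult_le_of_mem_support_step p j b hbj s ho hr
  -- the second chart is `i₀`
  have hj' : j' = i₀ := by
    by_contra h
    have := shade_step_le_of_not_dvd_apply p j' b' hbj' (step p j b s) ho₁ hpo₁ hr₁
      (Ne.symm h) (Or.inr hr1i₀) hE hEdeg hEi₀
    exact absurd this (not_le.mpr hinc')
  subst hj'
  obtain ⟨hpdvd₁, hfix₁, -⟩ :=
    necessary_of_shadeIncreases p j' b' hbj' (step p j b s) hclean₁ ho₁ hpo₁ hr₁ hinc'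
  -- a third index with an exponent prime to `p` in `E`
  have hEjdvd : p ∣ E j := by
    rw [hEj]
    have : o = (o - p) + p := by omega
    rw [this] at hpdvd
    exact (Nat.dvd_add_left (dvd_refl p)).mp hpdvd
  obtain ⟨i₁, hi₁j, hi₁j', hEi₁⟩ : ∃ i₁, i₁ ≠ j ∧ i₁ ≠ j' ∧ ¬ p ∣ E i₁ := by
    by_contra hc
    push Not at hc
    apply hEi₀
    have hsum : p ∣ ∑ i ∈ univ.erase j', E i := by
      refine Finset.dvd_sum fun i hi => ?_
      have hij' : i ≠ j' := Finset.ne_of_mem_erase hi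
      by_cases hij : i = j
      · rw [hij]; exact hEjdvd
      · exact hc i hij hij'
    have htot : p ∣ E.degree := hEdeg ▸ hpdvd₁
    rw [degree_eq_add_sum_erase j' E] at htot
    exact (Nat.dvd_add_left hsum).mp htot
  have hnot : ¬ (b' i₁ = 0 ∨ (step p j b s).r i₁ = 0) := fun h =>
    hEi₁ (hfix₁ i₁ hi₁j' h E hE hEdeg)
  push Not at hnot
  obtain ⟨hb'i₁, hr1i₁⟩ := hnot
  have hr1i₁' : (step p j b s).r i₁ = if b i₁ = 0 then s.r i₁ else 0 := by
    show newMult p j b s i₁ = _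
    rw [newMult_eq p j b hbj s ho, Finsupp.filter_apply, Finsupp.update_apply, if_neg hi₁j]
  have hbi₁ : b i₁ = 0 := by
    by_contra h
    rw [hr1i₁', if_neg h] at hr1i₁
    exact hr1i₁ rfl
  have hri₁ : s.r i₁ ≠ 0 := by
    rw [hr1i₁', if_pos hbi₁] at hr1i₁
    exact hr1i₁
  exact ⟨⟨hbi₀, hri₀, hr1i₀⟩, hpdvd, ⟨o₁, ho₁, hpdvd₁⟩, i₁, hi₁j, hi₁j', hbi₁, hri₁, hr1i₁, hb'i₁⟩

/-- **Surfaces: no two consecutive kangaroo jumps.** With at most two residual variables (a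
purely inseparable SURFACE `x^p + F(y₁, y₂) = 0`, or a curve), an increase of the shade is
never followed by another increase at the next point blow-up (whatever chart, whatever point of
the exceptional divisor with order still `p`) — three pairwise distinct indices `j, j′, i₁`
would be needed (`consecutive_shadeIncreases`). Hauser (2010, p. 16) reports Moh's remark
"in the next blowup the shade has to drop at least by 1 (if `e = 1`)"; what is proved here is
the non-increase (superseded by the dimension-free `not_shadeIncreases_step_of_shadeIncreases`
below; kept as the pigeonhole instance). [cite: Hauser2010, §F (p. 16)] [cite: Moh1987, §1 (p. 972)] -/
theorem not_consecutive_shadeIncreases_of_card_le_two (hcard : Fintype.card σ ≤ 2)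
    (j : σ) (b : σ → K) (hbj : b j = 0)
    (s : State σ K) (hclean : deletePthPowers p s.F = s.F) {o : ℕ} (ho : ordZero s.F = o)
    (hpo : p ≤ o) (hr : ∀ d ∈ s.F.support, s.r ≤ d) (hinc : ShadeIncreases p j b s)
    (j' : σ) (b' : σ → K) (hbj' : b' j' = 0) (hord : (p : ℕ∞) ≤ ordZero (step p j b s).F) :
    ¬ ShadeIncreases p j' b' (step p j b s) := by
  intro hinc'
  obtain ⟨⟨hbj'0, -, -⟩, -, -, i₁, hi₁j, hi₁j', -, -, -, -⟩ :=
    consecutive_shadeIncreases p j b hbj s hclean ho hpo hr hinc j' b' hbj' hord hinc'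
  have hjj' : j ≠ j' := fun h => hbj'0 (h ▸ hbj)
  have h3 : 2 < Fintype.card σ :=
    Fintype.two_lt_card_iff.mpr ⟨j, j', i₁, hjj', Ne.symm hi₁j, Ne.symm hi₁j'⟩
  omega

/-! ### No two consecutive increases, in every dimension -/

/-- **A step of a cleaned state is never the zero polynomial** (so orders stay finite along a
sequence): by the two probes, the cleaned translated chart transform has a monomial. [folklore] -/
theorem step_F_ne_zero (j : σ) (b : σ → K) (hbj : b j = 0) (s : State σ K)
    (hclean : deletePthPowers p s.F = s.F) {o : ℕ} (ho : ordZero s.F = o) (hpo : p ≤ o)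
    (hr : ∀ d ∈ s.F.support, s.r ≤ d) : (step p j b s).F ≠ 0 := by
  intro h0
  by_cases hdvd : p ∣ o
  · obtain ⟨⟨d₀, hd₀, hd₀deg⟩, -⟩ := (ordZero_eq_nat_iff _ _).mp ho
    have hd₀s : d₀ ∈ s.F.support := MvPolynomial.mem_support_iff.mpr hd₀
    obtain ⟨i₀, hi₀, hd₀i⟩ := exists_ne_not_dvd p j (hd₀deg.symm ▸ hdvd)
      (not_isPthPowerExponent_of_clean p hclean hd₀s)
    obtain ⟨E, hE, -⟩ :=
      exists_support_step_of_not_dvd_apply p j b hbj s ho hpo hr hi₀ hd₀s hd₀deg hd₀i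
    rw [h0, MvPolynomial.support_zero] at hE
    exact Finset.notMem_empty _ hE
  · obtain ⟨E, hE, -⟩ := exists_support_step_of_not_dvd p j b hbj s ho hpo hr hdvd
    rw [h0, MvPolynomial.support_zero] at hE
    exact Finset.notMem_empty _ hE

/-- **No two consecutive increases at order `p`, in every dimension.** If the shade increases
at the point `b` of the `y_j`-chart, then at the NEXT point blow-up of the new state — any
chart `y_{j′}`, any point `b′` of its exceptional divisor at which the order is still `p` — the
shade does NOT increase again. Every field of characteristic `p`, every number of residual
variables, cleaned states with `y^r ∣ F`.
Proof (derived here from the probes; the printed remarks it sharpens: [Moh87] p. 972 cases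
(1)–(2), [Ha10] p. 16 "in the next blowup the shade has to drop at least by 1 (if `e = 1`)",
[HP19] §3 "known to be valid for `e = 1`"): let `y^E` be the initial monomial of `F′` of
`exists_nonexceptional_of_shadeIncreases` (`p ∤ E_{i₀}`, `E_j = ord₀F − p ≡ 0`). A second
increase forces `j′ = i₀` and `p ∣ |E|` (`shade_step_step_le_of_shadeIncreases`,
`necessary_of_shadeIncreases`). The monomial `y^E` comes from an INITIAL monomial `y^d` of `F`
(`E_j = |d| − p`), with `E_i = d_i` at every untranslated `i ≠ j`, where `p ∣ d_i` by
`necessary_of_shadeIncreases` (ii) at the first step; so `p ∣ Σ_{b_i ≠ 0} E_i`, and since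
`p ∤ E_{i₀}` there is a second TRANSLATED index `i₂ ≠ i₀` with `p ∤ E_{i₂}` — non-exceptional
in the new state (`r′_{i₂} = 0`), `≠ j′`: `shade_step_le_of_not_dvd_apply` forbids the second
increase. [cite: Moh1987, §1 (p. 972)] [cite: Hauser2010, §F (p. 16)]
[cite: HauserPerlega2019, §3] -/
theorem not_shadeIncreases_step_of_shadeIncreases (j : σ) (b : σ → K) (hbj : b j = 0)
    (s : State σ K) (hclean : deletePthPowers p s.F = s.F) {o : ℕ} (ho : ordZero s.F = o)
    (hpo : p ≤ o) (hr : ∀ d ∈ s.F.support, s.r ≤ d) (hinc : ShadeIncreases p j b s)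
    (j' : σ) (b' : σ → K) (hbj' : b' j' = 0) (hord : (p : ℕ∞) ≤ ordZero (step p j b s).F) :
    ¬ ShadeIncreases p j' b' (step p j b s) := by
  intro hinc'
  have hdeg := le_degree_of_ordZero_eq s ho
  obtain ⟨hpdvd, hfix, -⟩ := necessary_of_shadeIncreases p j b hbj s hclean ho hpo hr hinc
  obtain ⟨i₀, hi₀, hbi₀, hri₀, hr1i₀, o₁, ho₁, -, E, hE, hEdeg, hEi₀, hEj⟩ :=
    exists_nonexceptional_of_shadeIncreases p j b hbj s hclean ho hpo hr hinc
  have hpo₁ : p ≤ o₁ := by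
    rw [ho₁] at hord
    exact_mod_cast hord
  have hclean₁ := deletePthPowers_step p j b s
  have hr₁ := newMult_le_of_mem_support_step p j b hbj s ho hr
  -- the second chart is `i₀` and `p ∣ o₁`
  have hj' : j' = i₀ := by
    by_contra h
    have := shade_step_le_of_not_dvd_apply p j' b' hbj' (step p j b s) ho₁ hpo₁ hr₁
      (Ne.symm h) (Or.inr hr1i₀) hE hEdeg hEi₀
    exact absurd this (not_le.mpr hinc')
  obtain ⟨hpdvd₁, -, -⟩ :=
    necessary_of_shadeIncreases p j' b' hbj' (step p j b s) hclean₁ ho₁ hpo₁ hr₁ hinc'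
  -- the source monomial `y^d` of `y^E`: initial in `F`, with `E_i = d_i` at untranslated `i`
  have hEG : coeff E (pointTransform p j b s) ≠ 0 := by
    have h := MvPolynomial.mem_support_iff.mp hE
    change coeff E (deletePthPowers p (pointTransform p j b s)) ≠ 0 at h
    rw [coeff_deletePthPowers] at h
    split_ifs at h with hP
    · exact (h rfl).elim
    · exact h
  rw [pointTransform_eq_sum, coeff_sum] at hEG
  obtain ⟨d, hd, hne⟩ := Finset.exists_ne_zero_of_sum_ne_zero hEG
  have hdo : d.degree = o := by
    have h1 : E j = chartExponent p j d j := apply_eq_of_coeff_translate_monomial_ne_zero b hbj hne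
    rw [chartExponent_apply, if_pos rfl, hEj] at h1
    have h2 := hdeg d hd
    omega
  have hEfix : ∀ i, i ≠ j → b i = 0 → E i = d i := by
    intro i hij hbi
    rw [apply_eq_of_coeff_translate_monomial_ne_zero b hbi hne, chartExponent_apply, if_neg hij]
  -- a second translated index with an exponent prime to `p`
  obtain ⟨i₂, hbi₂, hi₂, hEi₂⟩ : ∃ i₂, b i₂ ≠ 0 ∧ i₂ ≠ i₀ ∧ ¬ p ∣ E i₂ := by
    by_contra hc
    push Not at hc
    apply hEi₀
    have hEjdvd : p ∣ E j := by
      rw [hEj]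
      have : o = (o - p) + p := by omega
      rw [this] at hpdvd
      exact (Nat.dvd_add_left (dvd_refl p)).mp hpdvd
    have hsum : p ∣ ∑ i ∈ univ.erase i₀, E i := by
      refine Finset.dvd_sum fun i hi => ?_
      have hii₀ : i ≠ i₀ := Finset.ne_of_mem_erase hi
      by_cases hbi : b i = 0
      · by_cases hij : i = j
        · rw [hij]; exact hEjdvd
        · rw [hEfix i hij hbi]
          exact hfix i hij (Or.inl hbi) d hd hdo
      · exact hc i hbi hii₀
    have htot : p ∣ E.degree := hEdeg ▸ hpdvd₁
    rw [degree_eq_add_sum_erase i₀ E] at htot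
    exact (Nat.dvd_add_left hsum).mp htot
  -- `i₂` is non-exceptional in the new state and differs from the second chart
  have hr1i₂ : (step p j b s).r i₂ = 0 := by
    show newMult p j b s i₂ = 0
    rw [newMult_eq p j b hbj s ho, Finsupp.filter_apply, if_neg hbi₂]
  have hi₂j' : i₂ ≠ j' := by rw [hj']; exact hi₂
  have := shade_step_le_of_not_dvd_apply p j' b' hbj' (step p j b s) ho₁ hpo₁ hr₁
    hi₂j' (Or.inr hr1i₂) hE hEdeg hEi₂
  exact absurd this (not_le.mpr hinc')

/-- **Along a sequence of point blow-ups (order `p` throughout): increases are isolated** —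
an increase at step `n` is followed by a non-increase at step `n + 1`; in particular over any
two consecutive steps the shade rises by at most one. Every dimension, `e = 1`.
[cite: Moh1987, Stability Theorem and §1 (p. 972)] [cite: Hauser2010, §F (p. 16)] -/
theorem shade_isolated_increases_along (s : ℕ → State σ K) (j : ℕ → σ) (b : ℕ → σ → K)
    (hb : ∀ n, b n (j n) = 0) (hstep : ∀ n, s (n + 1) = step p (j n) (b n) (s n))
    (hF0 : (s 0).F ≠ 0) (hclean : deletePthPowers p (s 0).F = (s 0).F)
    (hr : ∀ d ∈ (s 0).F.support, (s 0).r ≤ d) (hord : ∀ n, (p : ℕ∞) ≤ ordZero (s n).F)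
    (n : ℕ) :
    ((s n).shade < (s (n + 1)).shade → (s (n + 2)).shade ≤ (s (n + 1)).shade) ∧
    (s (n + 2)).shade ≤ (s n).shade + 1 := by
  -- invariants along the sequence: non-zero, cleaned, divisible by the exceptional monomial
  have hinv : ∀ n, (s n).F ≠ 0 ∧ deletePthPowers p (s n).F = (s n).F ∧
      ∀ d ∈ (s n).F.support, (s n).r ≤ d := by
    intro n
    induction n with
    | zero => exact ⟨hF0, hclean, hr⟩
    | succ n ih =>
      obtain ⟨ih0, ih1, ih2⟩ := ih
      have hne : ordZero (s n).F ≠ ⊤ := by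
        unfold ordZero
        rw [Ne, MvPowerSeries.order_eq_top_iff, MvPolynomial.coe_eq_zero_iff]
        exact ih0
      obtain ⟨o, ho'⟩ := WithTop.ne_top_iff_exists.mp hne
      have ho : ordZero (s n).F = o := ho'.symm
      have hpo : p ≤ o := by
        have := hord n
        rw [ho] at this
        exact_mod_cast this
      rw [hstep n]
      exact ⟨step_F_ne_zero p (j n) (b n) (hb n) (s n) ih1 ho hpo ih2,
        deletePthPowers_step p (j n) (b n) (s n),
        newMult_le_of_mem_support_step p (j n) (b n) (hb n) (s n) ho ih2⟩
  obtain ⟨h0, h1, h2⟩ := hinv n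
  have hne : ordZero (s n).F ≠ ⊤ := by
    unfold ordZero
    rw [Ne, MvPowerSeries.order_eq_top_iff, MvPolynomial.coe_eq_zero_iff]
    exact h0
  obtain ⟨o, ho'⟩ := WithTop.ne_top_iff_exists.mp hne
  have ho : ordZero (s n).F = o := ho'.symm
  have hpo : p ≤ o := by
    have := hord n
    rw [ho] at this
    exact_mod_cast this
  have hfirst : (s n).shade < (s (n + 1)).shade → (s (n + 2)).shade ≤ (s (n + 1)).shade := by
    intro hlt
    have hinc : ShadeIncreases p (j n) (b n) (s n) := by
      unfold ShadeIncreases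
      rw [← hstep n]
      exact hlt
    have hord1 : (p : ℕ∞) ≤ ordZero (step p (j n) (b n) (s n)).F := by
      rw [← hstep n]; exact hord (n + 1)
    have := not_shadeIncreases_step_of_shadeIncreases p (j n) (b n) (hb n) (s n) h1 ho hpo h2
      hinc (j (n + 1)) (b (n + 1)) (hb (n + 1)) hord1
    unfold ShadeIncreases at this
    rw [← hstep n, ← hstep (n + 1)] at this
    exact not_lt.mp this
  refine ⟨hfirst, ?_⟩
  have hM1 := shade_succ_le_along p s j b hb hstep hclean hr hord n
  have hM2 := shade_succ_le_along p s j b hb hstep hclean hr hord (n + 1)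
  by_cases hlt : (s n).shade < (s (n + 1)).shade
  · exact le_trans (hfirst hlt) hM1
  · exact le_trans hM2 (add_le_add (not_lt.mp hlt) le_rfl)

end Main

end PointBlowup

end Literature.AlgebraicGeometry.Resolution
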